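import Literature.MathematicalPhysics.QuantumFieldTheory.Balaban1983to89.B15Extension193
import Literature.MathematicalPhysics.QuantumFieldTheory.Balaban1983to89.B15TreeGauge196

/-!
# `Balaban1983to89.B15ShellGauge193` — [Balaban1989LargeFieldI] p. 193: the GENERALIZED AXIAL GAUGE ON THE WHOLE SHELL of
# a parallelepiped `Λ` (`d ≥ 3`), the surface-bond bound `|V^g(b) − 1| ≤ 3d(n+2)²ε` on EVERY bond of the shell, and the
# extension lemma of p. 193 with ALL plaquettes regular — the corner plaquettes of GAPS G-B15-02 included (row `B15.Lem@193`)

statement-level skeleton of published theorems with citation tags; proofs where landed; nothing here is a claim about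
the Yang–Mills mass gap.

THE PRINTED SENTENCES (p. 193 [PDF 19], verbatim as in `B15Extension193`; v1.1: v1's light paraphrase inside the quotation marks
— «Let us take … satisfying there …», «([14])», «In this gauge …, satisfying …», «defined on the whole domain and equal …» — replaced by
the printed words, `lit-balaban-r12/QUOTE-AUDIT-B15.md` L8; docstring only): *"Take a configuration V_k defined on Z∩Λ^c and
satisfying the regularity condition |V_k(∂p′) − 1| < ε for p′ ⊂ Z∩Λ^c, ε > 0 is sufficiently small. … Introduce a generalized
axial gauge on the surface ∂⁺Λ. The configuration V_k⌈_{∂⁺Λ} is transformed into a small configuration V′_k, |V′_k(b′) − 1| <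
O(1)M²ε for b′ ⊂ ∂⁺Λ. We extend it putting V′_k(b′) = 1 for b′ ∈ Λ. The extended configuration satisfies the regularity condition
|V′_k(∂p′) − 1| < O(1)M²ε for p′ ⊂ Λ ∪ ∂⁺Λ. Now we apply the inverse gauge transformation on ∂⁺Λ, and we get a configuration V_k
defined on the whole domain, equal to the given one on Z∩Λ^c"* (the generalized axial gauge is [14]'s).

WHAT THIS FILE ADDS TO `B15Extension193` (which PROVED the construction for any `Λ` and any surface gauge, and the surface
gauge of a box FACE BY FACE).  Reading note (R2)/GAPS G-B15-02 there: with the face-wise gauges the plaquettes having one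
corner in `Λ` and one corner outside `Λ ∪ ∂⁺Λ` (around the edges of the box) are not controlled — the faces of `∂⁺Λ` are
pairwise non-adjacent on the lattice and their axial gauges are unrelated.  Here the gauge is ONE tree gauge on the whole
`ℓ^∞`-shell `S = [lo − 1, hi + 1] \ [lo, hi]` of the box (faces, edges, corners): `g(y) = V(Γ_y)` with `Γ_y` the path from the
corner `lo − 1` that first sweeps the coordinates of `y` sitting on an upper face (`y_κ = hi_κ + 1`) across the whole box, in
increasing order of `κ`, and then raises the remaining coordinates from `lo_κ − 1` to `y_κ`, again in increasing order
(`pathWord`, `shellFn`).  For `y ∈ S` every point of `Γ_y` has a frozen coordinate (`= lo − 1` or `= hi + 1`) other than the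
direction of motion, so `Γ_y ⊂ S`; and for a bond `⟨y, y + e_μ⟩` of `S` the quantity `g(y)V(y, y + e_μ)g(y + e_μ)⁻¹` is
  * (case `y_μ < hi_μ`, `dist1_shellAct_le_of_lt`) conjugate to the LADDER of the tail of `Γ_y` after `μ` — at most `d(n+2)`
    plaquettes of `S` (`conj_ladder_identity`, `dist1_ladder_tw_le`);
  * (case `y_μ = hi_μ`, `dist1_shellAct_le_of_eq`: `μ` becomes an upper coordinate of `y + e_μ` and is swept first) the same
    ladder times a conjugated RECTANGLE of height `hi_μ − lo_μ + 2 ≤ n + 2` over the block of `Γ_y` between the two positions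
    of the `μ`-segment (`swap_identity`, `caseB_identity`, `dist1_thick_tw_le_full` for the upper sweeps after `μ` — here
    `d ≥ 3` enters: while sweeping an upper coordinate `κ ≠ μ` the plaquettes `(κ, μ)` need a THIRD frozen coordinate
    — and `dist1_thick_tw_le` for the lower moves before `μ`),
whence `|V^g(b) − 1| ≤ 3d(n+2)²ε` (`dist1_shellAct_le`; `n + 1` ≥ sites per direction, so `3d(n+2)² ≤ 12dM²`: the printed
`O(1)M²`).  On the torus (`§C`) every plaquette is either a plaquette of `Λᶜ` or has all its corners in `Λ ∪ S`
(`corners_subset_of_not_mem_outPlaqs`), so the extension `V̂ = extend Λ (shellGauge V lo hi) V` of `B15Extension193` is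
regular on EVERY plaquette: `|V̂(∂p) − 1| ≤ 12d(n+2)²ε < (48d + 1)M²ε` (`extension_shell_box`, `extension193_shell_box`,
`extension193_shell_cube`), i.e. the typed leaf `B15.PrelimIntegrations.Extension193 outB outP Set.univ (48d+1) M ε`.

READING / DICTIONARY.  `ℤ^d` words and transport: `B7Prop1Explicit` (`hol`, `seg`, `ladder`, `plaqWord`, `gaugeAct`),
`B8Lemma1NonAbelian.tw` (multi-segment monotone words), `B15TreeGauge196Walks`/`B15TreeGauge196` (`tw_append`,
`disp_tw`, `restrict`, `tw_split`, `seg_add_one_of_nonneg` BY NAME — the p. 196 tree-gauge files of this paper);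
torus transport `T4AxialGaugeSmallField` (`castSite`, `pull`, plaquette dictionary); the sets and the construction
`B15Extension193` (`boxSites`, `outBonds`, `outPlaqs`, `corners`, `primed`, `extend`, `castSite_inj_big`).  Plaquette
hypothesis on `ℤ^d`: `ShellPlaqSmall V lo hi ε` — every unit plaquette based at a point with a frozen coordinate outside
its two directions is `ε`-small; it follows from the torus hypothesis `PlaqSmallOn (outPlaqs Λ) ε U` for `V = pull U` WITHOUT
any injectivity (`castSite_not_mem_boxSites_of_frozen`: a frozen coordinate alone keeps the projection off `Λ`, margin
`hi − lo + 3 < sitesPerDir`).  In `d = 2` the shell is a cycle around `Λ` and no gauge on it can make all its bonds small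
(the holonomy around `Λ` is gauge invariant); the hypothesis `3 ≤ d` is therefore not an artefact (the paper has `d = 3, 4`).

CONTENTS.  §A ladders and rectangles on `ℤ^d` under `ShellPlaqSmall` (all PROVED, [folklore] non-abelian Stokes
bookkeeping); §B the shell path gauge and the bond bound (PROVED); §C the torus shell gauge, the plaquette dichotomy for a
box, the corner-set form of the regularity transfer, and the typed leaf with `allP = Set.univ` (PROVED).  No `def … : Prop`
facts; every declaration carries `[cite: Balaban1989LargeFieldI, p.193]` or `[folklore]`.
-/

noncomputable section

open Set

namespace Literature.MathematicalPhysics.QuantumFieldTheory.Balaban1983to89.B15ShellGauge193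

open B7Prop1Explicit (Letter e e_apply disp disp_nil disp_cons disp_append hol hol_nil hol_cons hol_append stepHol
  stepHol_true seg seg_natCast seg_zero disp_seg length_seg hol_seg_succ ladder hol_ladder hol_ladder_cons plaqWord
  lplaqWord lplaqWord_true gaugeAct)
open B8Lemma1NonAbelian (tw tw_nil tw_cons tw_congr zsmul_e_apply zsmul_e_apply_self e_nonneg)
open B15TreeGauge196 (tw_append length_tw length_tw_le disp_tw restrict restrict_apply_of_mem restrict_apply_of_not_mem
  tw_split seg_add_one_of_nonneg)

/-! ## §A  Group level on `ℤ^d`: ladders and rectangles («thick ladders») under a frozen-coordinate plaquette hypothesis -/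

section ZdAlgebra

variable {d : ℕ} {G : Type*} [GaugeGroup G]

/-- A coordinate `κ₀` of the point `z` is FROZEN OUT OF RANGE: `z κ₀ = lo κ₀ − 1` or `z κ₀ = hi κ₀ + 1` (the two shell values
of the big box `[lo − 1, hi + 1]` around the parallelepiped `[lo, hi]`). [cite: Balaban1989LargeFieldI, p.193] -/
def Frozen (lo hi : Fin d → ℤ) (κ₀ : Fin d) (z : Fin d → ℤ) : Prop := z κ₀ = lo κ₀ - 1 ∨ z κ₀ = hi κ₀ + 1

/-- THE PLAQUETTE HYPOTHESIS at the `ℤ^d` level: every unit plaquette spanned by `e_κ, e_ν` and based at a point with a frozen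
coordinate `κ₀ ∉ {κ, ν}` (so that ALL FOUR corners have that coordinate out of the range `[lo κ₀, hi κ₀]`, hence lie off the
parallelepiped) satisfies `|V(∂p) − 1| ≤ ε` — the pull-back of p. 193's *"|V_k(∂p′) − 1| < ε for p′ ⊂ Z∩Λ^c"*
(`shellPlaqSmall_pull`, §C). [cite: Balaban1989LargeFieldI, p.193] -/
def ShellPlaqSmall (V : (Fin d → ℤ) → Fin d → G) (lo hi : Fin d → ℤ) (ε : ℝ) : Prop :=
  ∀ (z : Fin d → ℤ) (κ ν κ₀ : Fin d), κ ≠ ν → κ₀ ≠ κ → κ₀ ≠ ν → Frozen lo hi κ₀ z →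
    dist1 (hol V z (plaqWord κ ν)) ≤ ε

omit [GaugeGroup G] in
/-- A frozen coordinate stays frozen under moves in the other directions. [folklore] -/
private theorem Frozen.add_zsmul {lo hi : Fin d → ℤ} {κ₀ : Fin d} {z : Fin d → ℤ} (h : Frozen lo hi κ₀ z) {κ : Fin d}
    (hκ : κ₀ ≠ κ) (n : ℤ) : Frozen lo hi κ₀ (z + n • e κ) := by
  unfold Frozen at h ⊢
  simpa [zsmul_e_apply, e_apply, hκ] using h

omit [GaugeGroup G] in
/-- … in particular under one step `+e_κ`, `κ ≠ κ₀`. [folklore] -/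
private theorem Frozen.add_e {lo hi : Fin d → ℤ} {κ₀ : Fin d} {z : Fin d → ℤ} (h : Frozen lo hi κ₀ z) {κ : Fin d}
    (hκ : κ₀ ≠ κ) : Frozen lo hi κ₀ (z + e κ) := by
  simpa using h.add_zsmul hκ 1

omit [GaugeGroup G] in
/-- … and under any displacement vanishing in the coordinate `κ₀`. [folklore] -/
private theorem Frozen.add_of_apply_eq_zero {lo hi : Fin d → ℤ} {κ₀ : Fin d} {z : Fin d → ℤ} (h : Frozen lo hi κ₀ z)
    {v : Fin d → ℤ} (hv : v κ₀ = 0) : Frozen lo hi κ₀ (z + v) := by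
  unfold Frozen at h ⊢
  simpa [hv] using h

/-- THE TRIVIAL LADDER: `ladder [] μ = [+e_μ, −e_μ]` has holonomy `1`. [folklore] -/
private theorem hol_ladder_nil (V : (Fin d → ℤ) → Fin d → G) (x : Fin d → ℤ) (μ : Fin d) : hol V x (ladder [] μ) = 1 := by
  rw [hol_ladder]; simp

/-- **(S1) THE STRAIGHT LADDER**: along the segment `[x, x + n e_κ]`, the ladder in direction `μ` (a `1 × n` rectangle in the
`(κ, μ)`-plane) has `|V(ladder) − 1| ≤ n·ε` when a third coordinate `κ₀` is frozen at `x` (each of its `n` plaquettes is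
`ε`-small by `ShellPlaqSmall`; recursion `hol_ladder_cons`). (step of the proof of the p. 193 surface-gauge bound) [cite: Balaban1989LargeFieldI, p.193] -/
theorem dist1_ladder_seg_le {V : (Fin d → ℤ) → Fin d → G} {lo hi : Fin d → ℤ} {ε : ℝ} (hV : ShellPlaqSmall V lo hi ε)
    (hε : 0 ≤ ε) {κ μ κ₀ : Fin d} (hκμ : κ ≠ μ) (h0κ : κ₀ ≠ κ) (h0μ : κ₀ ≠ μ) :
    ∀ (n : ℕ) (x : Fin d → ℤ), Frozen lo hi κ₀ x → dist1 (hol V x (ladder (seg κ n) μ)) ≤ n * ε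
  | 0, x, _ => by rw [seg_natCast, List.replicate_zero, hol_ladder_nil, GaugeGroup.dist1_one]; simp
  | n + 1, x, hx => by
    rw [seg_natCast, List.replicate_succ, ← seg_natCast, hol_ladder_cons, lplaqWord_true]
    have ih := dist1_ladder_seg_le hV hε hκμ h0κ h0μ n (x + e κ) (hx.add_e h0κ)
    have hp := hV x κ μ κ₀ hκμ h0κ h0μ hx
    calc dist1 (stepHol V x (κ, true) * hol V (x + Letter.vec (κ, true)) (ladder (seg κ ↑n) μ) *
            (stepHol V x (κ, true))⁻¹ * hol V x (plaqWord κ μ))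
        ≤ dist1 (stepHol V x (κ, true) * hol V (x + Letter.vec (κ, true)) (ladder (seg κ ↑n) μ) *
            (stepHol V x (κ, true))⁻¹) + dist1 (hol V x (plaqWord κ μ)) := GaugeGroup.dist1_mul_le _ _
      _ = dist1 (hol V (x + e κ) (ladder (seg κ ↑n) μ)) + dist1 (hol V x (plaqWord κ μ)) := by
          rw [GaugeGroup.dist1_conj]; rfl
      _ ≤ n * ε + ε := add_le_add ih hp
      _ = (n + 1 : ℕ) * ε := by push_cast; ring

/-- THE RECTANGLE («thick ladder») VALUE: the holonomy of the loop `W, then K steps +e_μ, then W backwards (translated), then K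
steps −e_μ` — `V(W)·V([e, e + Ke_μ])·V(W + Ke_μ)⁻¹·V([x, x + Ke_μ])⁻¹`, `e = x + disp W`. (step of the proof of the p. 193 surface-gauge bound) [cite: Balaban1989LargeFieldI, p.193] -/
def thick (V : (Fin d → ℤ) → Fin d → G) (x : Fin d → ℤ) (W : List (Letter d)) (μ : Fin d) (K : ℕ) : G :=
  hol V x W * hol V (x + disp W) (seg μ K) * (hol V (x + (K : ℤ) • e μ) W)⁻¹ * (hol V x (seg μ K))⁻¹

/-- Height `0`: the rectangle is degenerate, value `1`. [folklore] -/
private theorem thick_zero (V : (Fin d → ℤ) → Fin d → G) (x : Fin d → ℤ) (W : List (Letter d)) (μ : Fin d) :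
    thick V x W μ 0 = 1 := by
  simp [thick]

/-- The rectangle over the EMPTY word is degenerate, value `1`. [folklore] -/
private theorem thick_nil (V : (Fin d → ℤ) → Fin d → G) (x : Fin d → ℤ) (μ : Fin d) (K : ℕ) : thick V x [] μ K = 1 := by
  simp [thick]

/-- THE RECTANGLE RECURSION: raising the height by one multiplies by the conjugated ladder of `W` at height `K`. (step of the proof of the p. 193 surface-gauge bound) [cite: Balaban1989LargeFieldI, p.193] -/
theorem thick_succ (V : (Fin d → ℤ) → Fin d → G) (x : Fin d → ℤ) (W : List (Letter d)) (μ : Fin d) (K : ℕ) :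
    thick V x W μ (K + 1) = thick V x W μ K *
      (hol V x (seg μ K) * hol V (x + (K : ℤ) • e μ) (ladder W μ) * (hol V x (seg μ K))⁻¹) := by
  unfold thick
  have h1 : ((K + 1 : ℕ) : ℤ) = (K : ℤ) + 1 := by push_cast; ring
  rw [h1, hol_seg_succ, hol_seg_succ, hol_ladder, add_smul, one_smul,
    show x + disp W + (K : ℤ) • e μ = x + (K : ℤ) • e μ + disp W by abel,
    show x + ((K : ℤ) • e μ + e μ) = x + (K : ℤ) • e μ + e μ by abel]
  group

/-- **(L2) A RECTANGLE IS A STACK OF LADDERS**: if the ladder of `W` at every height `j < K` is within `B` of `1`, the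
height-`K` rectangle is within `K·B` (subadditivity and conjugation invariance of `dist1`). (step of the proof of the p. 193 surface-gauge bound) [cite: Balaban1989LargeFieldI, p.193] -/
theorem dist1_thick_le (V : (Fin d → ℤ) → Fin d → G) (x : Fin d → ℤ) (W : List (Letter d)) (μ : Fin d) {B : ℝ} :
    ∀ K : ℕ, (∀ j : ℕ, j < K → dist1 (hol V (x + (j : ℤ) • e μ) (ladder W μ)) ≤ B) → dist1 (thick V x W μ K) ≤ K * B
  | 0, _ => by rw [thick_zero, GaugeGroup.dist1_one]; simp
  | K + 1, h => by
    rw [thick_succ]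
    have ih := dist1_thick_le V x W μ K fun j hj => h j (Nat.lt_succ_of_lt hj)
    calc dist1 (thick V x W μ K * (hol V x (seg μ K) * hol V (x + (K : ℤ) • e μ) (ladder W μ) * (hol V x (seg μ K))⁻¹))
        ≤ dist1 (thick V x W μ K) + dist1 (hol V x (seg μ K) * hol V (x + (K : ℤ) • e μ) (ladder W μ) *
            (hol V x (seg μ K))⁻¹) := GaugeGroup.dist1_mul_le _ _
      _ = dist1 (thick V x W μ K) + dist1 (hol V (x + (K : ℤ) • e μ) (ladder W μ)) := by rw [GaugeGroup.dist1_conj]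
      _ ≤ K * B + B := add_le_add ih (h K (Nat.lt_succ_self K))
      _ = (K + 1 : ℕ) * B := by push_cast; ring

/-- **(S2) THE STRAIGHT RECTANGLE**: the `n × K` rectangle in the `(κ, μ)`-plane at a point with a frozen third coordinate has
`|V(∂) − 1| ≤ K·n·ε`. (step of the proof of the p. 193 surface-gauge bound) [cite: Balaban1989LargeFieldI, p.193] -/
theorem dist1_thick_seg_le {V : (Fin d → ℤ) → Fin d → G} {lo hi : Fin d → ℤ} {ε : ℝ} (hV : ShellPlaqSmall V lo hi ε)
    (hε : 0 ≤ ε) {κ μ κ₀ : Fin d} (hκμ : κ ≠ μ) (h0κ : κ₀ ≠ κ) (h0μ : κ₀ ≠ μ) (n K : ℕ) {x : Fin d → ℤ}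
    (hx : Frozen lo hi κ₀ x) : dist1 (thick V x (seg κ n) μ K) ≤ K * (n * ε) :=
  dist1_thick_le V x (seg κ n) μ K fun j _ => dist1_ladder_seg_le hV hε hκμ h0κ h0μ n _ (hx.add_zsmul h0μ j)

/-- **(C1) LADDER OF A CONCATENATION**: the ladder of `w₁ ++ w₂` is the ladder of `w₂` (at the end of `w₁`, conjugated by
`V(w₁)`) times the ladder of `w₁`. (step of the proof of the p. 193 surface-gauge bound) [cite: Balaban1989LargeFieldI, p.193] -/
theorem hol_ladder_append (V : (Fin d → ℤ) → Fin d → G) (x : Fin d → ℤ) (w₁ w₂ : List (Letter d)) (μ : Fin d) :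
    hol V x (ladder (w₁ ++ w₂) μ) =
      hol V x w₁ * hol V (x + disp w₁) (ladder w₂ μ) * (hol V x w₁)⁻¹ * hol V x (ladder w₁ μ) := by
  rw [hol_ladder, hol_ladder, hol_ladder, hol_append, hol_append, disp_append,
    show x + e μ + disp w₁ = x + disp w₁ + e μ by abel, ← add_assoc]
  group

/-- … hence `|V(ladder (w₁ ++ w₂)) − 1| ≤ |V(ladder w₂) − 1| + |V(ladder w₁) − 1|`. (step of the proof of the p. 193 surface-gauge bound) [cite: Balaban1989LargeFieldI, p.193] -/
theorem dist1_ladder_append_le (V : (Fin d → ℤ) → Fin d → G) (x : Fin d → ℤ) (w₁ w₂ : List (Letter d)) (μ : Fin d) :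
    dist1 (hol V x (ladder (w₁ ++ w₂) μ)) ≤
      dist1 (hol V (x + disp w₁) (ladder w₂ μ)) + dist1 (hol V x (ladder w₁ μ)) := by
  rw [hol_ladder_append]
  calc dist1 (hol V x w₁ * hol V (x + disp w₁) (ladder w₂ μ) * (hol V x w₁)⁻¹ * hol V x (ladder w₁ μ))
      ≤ dist1 (hol V x w₁ * hol V (x + disp w₁) (ladder w₂ μ) * (hol V x w₁)⁻¹) + dist1 (hol V x (ladder w₁ μ)) :=
        GaugeGroup.dist1_mul_le _ _
    _ = _ := by rw [GaugeGroup.dist1_conj]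

/-- **(C2) RECTANGLE OF A CONCATENATION**: `thick (w₁ ++ w₂) = V(w₁)·thick w₂·V(w₁)⁻¹ · thick w₁`. (step of the proof of the p. 193 surface-gauge bound) [cite: Balaban1989LargeFieldI, p.193] -/
theorem thick_append (V : (Fin d → ℤ) → Fin d → G) (x : Fin d → ℤ) (w₁ w₂ : List (Letter d)) (μ : Fin d) (K : ℕ) :
    thick V x (w₁ ++ w₂) μ K = hol V x w₁ * thick V (x + disp w₁) w₂ μ K * (hol V x w₁)⁻¹ * thick V x w₁ μ K := by
  unfold thick
  rw [hol_append, hol_append, disp_append, show x + (K : ℤ) • e μ + disp w₁ = x + disp w₁ + (K : ℤ) • e μ by abel,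
    ← add_assoc]
  group

/-- … hence `|thick (w₁ ++ w₂) − 1| ≤ |thick w₂ − 1| + |thick w₁ − 1|`. (step of the proof of the p. 193 surface-gauge bound) [cite: Balaban1989LargeFieldI, p.193] -/
theorem dist1_thick_append_le (V : (Fin d → ℤ) → Fin d → G) (x : Fin d → ℤ) (w₁ w₂ : List (Letter d)) (μ : Fin d)
    (K : ℕ) : dist1 (thick V x (w₁ ++ w₂) μ K) ≤
      dist1 (thick V (x + disp w₁) w₂ μ K) + dist1 (thick V x w₁ μ K) := by
  rw [thick_append]
  calc dist1 (hol V x w₁ * thick V (x + disp w₁) w₂ μ K * (hol V x w₁)⁻¹ * thick V x w₁ μ K)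
      ≤ dist1 (hol V x w₁ * thick V (x + disp w₁) w₂ μ K * (hol V x w₁)⁻¹) + dist1 (thick V x w₁ μ K) :=
        GaugeGroup.dist1_mul_le _ _
    _ = _ := by rw [GaugeGroup.dist1_conj]

/-- **(M1) THE LADDER OF A MULTI-SEGMENT MONOTONE WORD WITH A GLOBALLY FROZEN WITNESS**: for `tw ks v` (segments `seg κ (v κ)`,
`κ ∈ ks`, non-negative, directions `≠ μ`, and length `0` in the witness direction `κ₀` if listed) started at a point with
`κ₀` frozen: `|V(ladder) − 1| ≤ |tw ks v|·ε`. (step of the proof of the p. 193 surface-gauge bound) [cite: Balaban1989LargeFieldI, p.193] -/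
theorem dist1_ladder_tw_le {V : (Fin d → ℤ) → Fin d → G} {lo hi : Fin d → ℤ} {ε : ℝ} (hV : ShellPlaqSmall V lo hi ε)
    (hε : 0 ≤ ε) {μ κ₀ : Fin d} (h0μ : κ₀ ≠ μ) :
    ∀ (ks : List (Fin d)) (v x : Fin d → ℤ), (∀ κ ∈ ks, κ ≠ μ) → (∀ κ ∈ ks, 0 ≤ v κ) →
      (∀ κ ∈ ks, κ = κ₀ → v κ = 0) → Frozen lo hi κ₀ x →
      dist1 (hol V x (ladder (tw ks v) μ)) ≤ (tw ks v).length * ε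
  | [], v, x, _, _, _, _ => by rw [tw_nil, hol_ladder_nil, GaugeGroup.dist1_one]; simp
  | κ :: ks, v, x, hμ, hv, h0, hx => by
    rw [tw_cons]
    obtain ⟨n, hn⟩ := Int.eq_ofNat_of_zero_le (hv κ (by simp))
    have ih := dist1_ladder_tw_le hV hε h0μ ks v (x + disp (seg κ (v κ))) (fun κ' h => hμ κ' (by simp [h]))
      (fun κ' h => hv κ' (by simp [h])) (fun κ' h => h0 κ' (by simp [h])) (by
        rw [disp_seg]
        by_cases hκ : κ = κ₀
        · rw [h0 κ (by simp) hκ, zero_smul, add_zero]; exact hx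
        · exact hx.add_zsmul (Ne.symm hκ) _)
    have hseg : dist1 (hol V x (ladder (seg κ (v κ)) μ)) ≤ (seg κ (v κ)).length * ε := by
      by_cases hκ : κ = κ₀
      · rw [h0 κ (by simp) hκ, seg_zero, hol_ladder_nil, GaugeGroup.dist1_one]; simp
      · rw [hn, length_seg, Int.natAbs_natCast]
        exact dist1_ladder_seg_le hV hε (hμ κ (by simp)) (Ne.symm hκ) h0μ n x hx
    calc dist1 (hol V x (ladder (seg κ (v κ) ++ tw ks v) μ))
        ≤ dist1 (hol V (x + disp (seg κ (v κ))) (ladder (tw ks v) μ)) + dist1 (hol V x (ladder (seg κ (v κ)) μ)) :=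
          dist1_ladder_append_le V x _ _ μ
      _ ≤ (tw ks v).length * ε + (seg κ (v κ)).length * ε := add_le_add ih hseg
      _ = (seg κ (v κ) ++ tw ks v).length * ε := by rw [List.length_append]; push_cast; ring

/-- **(M2) THE RECTANGLE OVER A MULTI-SEGMENT MONOTONE WORD WITH A GLOBALLY FROZEN WITNESS**: height `K`,
`|thick − 1| ≤ K·|tw ks v|·ε`. (step of the proof of the p. 193 surface-gauge bound) [cite: Balaban1989LargeFieldI, p.193] -/
theorem dist1_thick_tw_le {V : (Fin d → ℤ) → Fin d → G} {lo hi : Fin d → ℤ} {ε : ℝ} (hV : ShellPlaqSmall V lo hi ε)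
    (hε : 0 ≤ ε) {μ κ₀ : Fin d} (h0μ : κ₀ ≠ μ) (K : ℕ) :
    ∀ (ks : List (Fin d)) (v x : Fin d → ℤ), (∀ κ ∈ ks, κ ≠ μ) → (∀ κ ∈ ks, 0 ≤ v κ) →
      (∀ κ ∈ ks, κ = κ₀ → v κ = 0) → Frozen lo hi κ₀ x →
      dist1 (thick V x (tw ks v) μ K) ≤ K * ((tw ks v).length * ε)
  | [], v, x, _, _, _, _ => by
    rw [tw_nil]
    refine (dist1_thick_le V x [] μ K (B := 0) fun j _ => ?_).trans (by simp)
    rw [hol_ladder_nil, GaugeGroup.dist1_one]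
  | κ :: ks, v, x, hμ, hv, h0, hx => by
    rw [tw_cons]
    obtain ⟨n, hn⟩ := Int.eq_ofNat_of_zero_le (hv κ (by simp))
    have ih := dist1_thick_tw_le hV hε h0μ K ks v (x + disp (seg κ (v κ))) (fun κ' h => hμ κ' (by simp [h]))
      (fun κ' h => hv κ' (by simp [h])) (fun κ' h => h0 κ' (by simp [h])) (by
        rw [disp_seg]
        by_cases hκ : κ = κ₀
        · rw [h0 κ (by simp) hκ, zero_smul, add_zero]; exact hx
        · exact hx.add_zsmul (Ne.symm hκ) _)
    have hseg : dist1 (thick V x (seg κ (v κ)) μ K) ≤ K * ((seg κ (v κ)).length * ε) := by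
      by_cases hκ : κ = κ₀
      · rw [h0 κ (by simp) hκ, seg_zero]
        refine (dist1_thick_le V x [] μ K (B := 0) fun j _ => ?_).trans (by simp)
        rw [hol_ladder_nil, GaugeGroup.dist1_one]
      · rw [hn, length_seg, Int.natAbs_natCast]
        exact dist1_thick_seg_le hV hε (hμ κ (by simp)) (Ne.symm hκ) h0μ n K hx
    calc dist1 (thick V x (seg κ (v κ) ++ tw ks v) μ K)
        ≤ dist1 (thick V (x + disp (seg κ (v κ))) (tw ks v) μ K) + dist1 (thick V x (seg κ (v κ)) μ K) :=
          dist1_thick_append_le V x _ _ μ K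
      _ ≤ K * ((tw ks v).length * ε) + K * ((seg κ (v κ)).length * ε) := add_le_add ih hseg
      _ = K * ((seg κ (v κ) ++ tw ks v).length * ε) := by rw [List.length_append]; push_cast; ring

/-- **(M2′) THE RECTANGLE OVER FULL SWEEPS FROM A FULLY FROZEN BASE** (the upper block of the shell path, `d ≥ 3`): if every
coordinate `≠ μ` of `x` is frozen and each listed coordinate (distinct, `≠ μ`) is either not moved (`v κ = 0`) or sits at
`lo − 1` and is swept fully to `hi + 1` (`v κ = hi κ − lo κ + 2`), then `|thick − 1| ≤ K·|tw ks v|·ε` — for each swept `κ` ANY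
third coordinate is a frozen witness. (step of the proof of the p. 193 surface-gauge bound) [cite: Balaban1989LargeFieldI, p.193] -/
theorem dist1_thick_tw_le_full {V : (Fin d → ℤ) → Fin d → G} {lo hi : Fin d → ℤ} {ε : ℝ} (hV : ShellPlaqSmall V lo hi ε)
    (hε : 0 ≤ ε) (hd : 3 ≤ d) (hlohi : lo ≤ hi) {μ : Fin d} (K : ℕ) :
    ∀ (ks : List (Fin d)) (v x : Fin d → ℤ), (∀ κ ∈ ks, κ ≠ μ) → ks.Nodup →
      (∀ κ ∈ ks, v κ = 0 ∨ (v κ = hi κ - lo κ + 2 ∧ x κ = lo κ - 1)) → (∀ ν, ν ≠ μ → Frozen lo hi ν x) →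
      dist1 (thick V x (tw ks v) μ K) ≤ K * ((tw ks v).length * ε)
  | [], v, x, _, _, _, _ => by
    rw [tw_nil, thick_nil, GaugeGroup.dist1_one]; simp
  | κ :: ks, v, x, hμ, hnd, hv, hfr => by
    rw [tw_cons]
    have hκμ : κ ≠ μ := hμ κ (by simp)
    have hκks : κ ∉ ks := (List.nodup_cons.mp hnd).1
    rcases hv κ (by simp) with h0 | ⟨hvκ, hxκ⟩
    · -- the coordinate `κ` is not moved: empty segment
      rw [h0, seg_zero, List.nil_append]
      exact dist1_thick_tw_le_full hV hε hd hlohi K ks v x (fun κ' h => hμ κ' (by simp [h]))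
        (List.nodup_cons.mp hnd).2 (fun κ' h => hv κ' (by simp [h])) hfr
    · have hn0 : 0 ≤ v κ := by rw [hvκ]; have := hlohi κ; linarith
      obtain ⟨n, hn⟩ := Int.eq_ofNat_of_zero_le hn0
      -- `d ≥ 3`: a third coordinate `ν ∉ {κ, μ}` is the frozen witness during the sweep of `κ`
      obtain ⟨ν, hνκ, hνμ⟩ : ∃ ν : Fin d, ν ≠ κ ∧ ν ≠ μ := by
        by_contra hcon
        push Not at hcon
        have e0 := hcon ⟨0, by omega⟩
        have e1 := hcon ⟨1, by omega⟩
        have e2 := hcon ⟨2, by omega⟩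
        rcases κ with ⟨a, ha⟩
        rcases μ with ⟨b, hb⟩
        simp only [ne_eq, Fin.mk.injEq, imp_iff_not_or, not_not] at e0 e1 e2
        omega
      -- the base after the sweep of `κ` is again fully frozen off `μ`; the other listed coordinates are unchanged
      have hx' : ∀ ν', ν' ≠ μ → Frozen lo hi ν' (x + disp (seg κ (v κ))) := by
        intro ν' hν'
        rw [disp_seg]
        by_cases h : ν' = κ
        · rw [h]
          refine Or.inr ?_
          rw [Pi.add_apply, zsmul_e_apply_self, hxκ, hvκ]
          ring
        · exact (hfr ν' hν').add_zsmul h _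
      have hxeq : ∀ κ' ∈ ks, (x + disp (seg κ (v κ))) κ' = x κ' := by
        intro κ' hκ'
        have hne : κ' ≠ κ := fun h => hκks (h ▸ hκ')
        rw [disp_seg, Pi.add_apply, zsmul_e_apply, if_neg hne, add_zero]
      have hv' : ∀ κ' ∈ ks, v κ' = 0 ∨ (v κ' = hi κ' - lo κ' + 2 ∧ (x + disp (seg κ (v κ))) κ' = lo κ' - 1) :=
        fun κ' hκ' => (hv κ' (by simp [hκ'])).imp_right fun h => ⟨h.1, (hxeq κ' hκ').trans h.2⟩
      have ih := dist1_thick_tw_le_full hV hε hd hlohi K ks v (x + disp (seg κ (v κ)))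
        (fun κ' h => hμ κ' (by simp [h])) (List.nodup_cons.mp hnd).2 hv' hx'
      have hseg : dist1 (thick V x (seg κ (v κ)) μ K) ≤ K * ((seg κ (v κ)).length * ε) := by
        rw [hn, length_seg, Int.natAbs_natCast]
        exact dist1_thick_seg_le hV hε hκμ hνκ hνμ n K (hfr ν hνμ)
      calc dist1 (thick V x (seg κ (v κ) ++ tw ks v) μ K)
          ≤ dist1 (thick V (x + disp (seg κ (v κ))) (tw ks v) μ K) + dist1 (thick V x (seg κ (v κ)) μ K) :=
            dist1_thick_append_le V x _ _ μ K
        _ ≤ K * ((tw ks v).length * ε) + K * ((seg κ (v κ)).length * ε) := add_le_add ih hseg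
        _ = K * ((seg κ (v κ) ++ tw ks v).length * ε) := by rw [List.length_append]; push_cast; ring

/-- `Frozen` depends on the frozen coordinate only. [folklore] -/
private theorem Frozen.of_apply_eq {lo hi : Fin d → ℤ} {κ₀ : Fin d} {z z' : Fin d → ℤ} (h : Frozen lo hi κ₀ z)
    (h' : z' κ₀ = z κ₀) : Frozen lo hi κ₀ z' := by
  unfold Frozen at h ⊢
  rw [h']
  exact h

/-- LENGTH BOOKKEEPING: a monotone multi-segment word over at most `d` directions with entries of size `≤ n + 2` has
`|tw ks v|·ε ≤ d(n + 2)ε`. [folklore] -/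
private theorem length_tw_mul_le {ks : List (Fin d)} {v : Fin d → ℤ} {n : ℕ} {ε : ℝ} (hks : ks.length ≤ d)
    (hv : ∀ κ ∈ ks, (v κ).natAbs ≤ n + 2) (hε : 0 ≤ ε) : ((tw ks v).length : ℝ) * ε ≤ d * (n + 2) * ε := by
  have h : (tw ks v).length ≤ d * (n + 2) := (length_tw_le hv).trans (Nat.mul_le_mul_right _ hks)
  have h' : ((tw ks v).length : ℝ) ≤ d * (n + 2) := by exact_mod_cast h
  exact mul_le_mul_of_nonneg_right h' hε

end ZdAlgebra

/-! ## §B  The shell path gauge on `ℤ^d`: `g(y) = V(Γ_y)`, `Γ_y` = (full sweeps of the upper coordinates of `y`, in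
increasing order) then (the remaining coordinates from `lo − 1` up to `y`, in increasing order), all from the corner `lo − 1` -/

section ShellPath

variable {d : ℕ} {G : Type*} [GaugeGroup G] {lo hi : Fin d → ℤ}

/-- The UPPER part of `y − (lo − 1)`: the coordinates of `y` sitting on an upper face (`y κ = hi κ + 1`), full length
`hi κ − lo κ + 2`; `0` elsewhere. [cite: Balaban1989LargeFieldI, p.193] -/
def vUp (lo hi y : Fin d → ℤ) : Fin d → ℤ := fun κ => if y κ = hi κ + 1 then y κ - (lo κ - 1) else 0

/-- The LOWER part of `y − (lo − 1)`: the other coordinates (`lo κ − 1 ≤ y κ ≤ hi κ`). [cite: Balaban1989LargeFieldI, p.193] -/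
def vLo (lo hi y : Fin d → ℤ) : Fin d → ℤ := fun κ => if y κ = hi κ + 1 then 0 else y κ - (lo κ - 1)

/-- THE SHELL PATH `Γ_y` from the corner `lo − 1` of the big box `[lo − 1, hi + 1]` to `y`: first the upper coordinates are
swept across the whole box (in increasing order of the coordinate index), then the remaining ones are raised to their values
(again in increasing order).  For `y` in the shell `[lo − 1, hi + 1] \ [lo, hi]` the path stays in the shell (every point has
a frozen coordinate other than the direction of motion) — the tree defining the *generalized axial gauge* of p. 193, here on
the whole shell instead of `∂⁺Λ`. [cite: Balaban1989LargeFieldI, p.193] -/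
def pathWord (lo hi y : Fin d → ℤ) : List (Letter d) :=
  tw (List.finRange d) (vUp lo hi y) ++ tw (List.finRange d) (vLo lo hi y)

/-- THE SHELL GAUGE FUNCTION `g(y) = V(Γ_y)` (parallel transport from the corner along the shell path).
[cite: Balaban1989LargeFieldI, p.193] -/
def shellFn (V : (Fin d → ℤ) → Fin d → G) (lo hi : Fin d → ℤ) (y : Fin d → ℤ) : G :=
  hol V (lo - 1) (pathWord lo hi y)

omit [GaugeGroup G] in
/-- `vUp` on an upper coordinate. [folklore] -/
private theorem vUp_of_up {y : Fin d → ℤ} {κ : Fin d} (h : y κ = hi κ + 1) : vUp lo hi y κ = hi κ - lo κ + 2 := by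
  simp only [vUp]
  rw [if_pos h, h]
  ring

omit [GaugeGroup G] in
/-- `vUp` off the upper coordinates. [folklore] -/
private theorem vUp_of_not_up {y : Fin d → ℤ} {κ : Fin d} (h : ¬ y κ = hi κ + 1) : vUp lo hi y κ = 0 := by
  simp only [vUp]
  rw [if_neg h]

omit [GaugeGroup G] in
/-- `vLo` on an upper coordinate. [folklore] -/
private theorem vLo_of_up {y : Fin d → ℤ} {κ : Fin d} (h : y κ = hi κ + 1) : vLo lo hi y κ = 0 := by
  simp only [vLo]
  rw [if_pos h]

omit [GaugeGroup G] in
/-- `vLo` off the upper coordinates. [folklore] -/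
private theorem vLo_of_not_up {y : Fin d → ℤ} {κ : Fin d} (h : ¬ y κ = hi κ + 1) : vLo lo hi y κ = y κ - (lo κ - 1) := by
  simp only [vLo]
  rw [if_neg h]

omit [GaugeGroup G] in
/-- The two parts add up to `y − (lo − 1)`. [folklore] -/
private theorem vUp_add_vLo (lo hi y : Fin d → ℤ) : vUp lo hi y + vLo lo hi y = y - (lo - 1) := by
  funext κ
  simp only [Pi.add_apply, Pi.sub_apply, Pi.one_apply, vUp, vLo]
  split_ifs <;> ring

omit [GaugeGroup G] in
/-- `restrict` to all directions is the identity. [folklore] -/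
private theorem restrict_finRange (v : Fin d → ℤ) : restrict (List.finRange d) v = v :=
  funext fun κ => restrict_apply_of_mem (List.mem_finRange κ) v

omit [GaugeGroup G] in
/-- The shell path ends at `y`: `disp Γ_y = y − (lo − 1)`. (step of the proof of the p. 193 surface-gauge bound) [cite: Balaban1989LargeFieldI, p.193] -/
theorem disp_pathWord (lo hi y : Fin d → ℤ) : disp (pathWord lo hi y) = y - (lo - 1) := by
  rw [pathWord, disp_append, disp_tw (List.nodup_finRange d), disp_tw (List.nodup_finRange d), restrict_finRange,
    restrict_finRange, vUp_add_vLo]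

omit [GaugeGroup G] in
/-- … i.e. `(lo − 1) + disp Γ_y = y`. (step of the proof of the p. 193 surface-gauge bound) [cite: Balaban1989LargeFieldI, p.193] -/
theorem bot_add_disp_pathWord (lo hi y : Fin d → ℤ) : (lo - 1) + disp (pathWord lo hi y) = y := by
  rw [disp_pathWord]; abel

omit [GaugeGroup G] in
/-- A FROZEN coordinate has lower part `0` (upper ⇒ by definition; lower face ⇒ `y κ₀ = lo κ₀ − 1`). [folklore] -/
private theorem vLo_eq_zero_of_frozen {κ₀ : Fin d} {y : Fin d → ℤ} (h : Frozen lo hi κ₀ y) : vLo lo hi y κ₀ = 0 := by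
  by_cases hup : y κ₀ = hi κ₀ + 1
  · exact vLo_of_up hup
  · rw [vLo_of_not_up hup]
    rcases h with h | h
    · rw [h]; ring
    · exact absurd h hup

omit [GaugeGroup G] in
/-- `vLo ≥ 0` on the big box. [folklore] -/
private theorem vLo_nonneg {y : Fin d → ℤ} (hy : lo - 1 ≤ y) (κ : Fin d) : 0 ≤ vLo lo hi y κ := by
  by_cases hup : y κ = hi κ + 1
  · rw [vLo_of_up hup]
  · rw [vLo_of_not_up hup]
    have := hy κ
    simp only [Pi.sub_apply, Pi.one_apply] at this
    linarith

omit [GaugeGroup G] in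
/-- `vLo κ ≤ hi κ − lo κ + 2` on the big box. [folklore] -/
private theorem vLo_le (hlohi : lo ≤ hi) {y : Fin d → ℤ} (hy' : y ≤ hi + 1) (κ : Fin d) : vLo lo hi y κ ≤ hi κ - lo κ + 2 := by
  have := hlohi κ
  by_cases hup : y κ = hi κ + 1
  · rw [vLo_of_up hup]; linarith
  · rw [vLo_of_not_up hup]
    have := hy' κ
    simp only [Pi.add_apply, Pi.one_apply] at this
    linarith

omit [GaugeGroup G] in
/-- `vUp ≥ 0`. [folklore] -/
private theorem vUp_nonneg (hlohi : lo ≤ hi) (y : Fin d → ℤ) (κ : Fin d) : 0 ≤ vUp lo hi y κ := by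
  by_cases hup : y κ = hi κ + 1
  · rw [vUp_of_up hup]; have := hlohi κ; linarith
  · rw [vUp_of_not_up hup]

omit [GaugeGroup G] in
/-- `vUp κ ≤ hi κ − lo κ + 2`. [folklore] -/
private theorem vUp_le (hlohi : lo ≤ hi) (y : Fin d → ℤ) (κ : Fin d) : vUp lo hi y κ ≤ hi κ - lo κ + 2 := by
  by_cases hup : y κ = hi κ + 1
  · rw [vUp_of_up hup]
  · rw [vUp_of_not_up hup]; have := hlohi κ; linarith

omit [GaugeGroup G] in
/-- Moving in direction `μ` does not change the other entries of `vUp`. [folklore] -/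
private theorem vUp_add_e_of_ne {y : Fin d → ℤ} {μ κ : Fin d} (hκ : κ ≠ μ) : vUp lo hi (y + e μ) κ = vUp lo hi y κ := by
  simp only [vUp, Pi.add_apply, e_apply, if_neg hκ, add_zero]

omit [GaugeGroup G] in
/-- Moving in direction `μ` does not change the other entries of `vLo`. [folklore] -/
private theorem vLo_add_e_of_ne {y : Fin d → ℤ} {μ κ : Fin d} (hκ : κ ≠ μ) : vLo lo hi (y + e μ) κ = vLo lo hi y κ := by
  simp only [vLo, Pi.add_apply, e_apply, if_neg hκ, add_zero]

omit [GaugeGroup G] in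
/-- THE BASE POINTS OF THE SHELL PATH ARE FROZEN: a point whose coordinate `κ` is `lo κ − 1 + c` with `c ∈ {0, vUp y κ}` has
`κ` frozen. [folklore] -/
private theorem frozen_of_eq {κ : Fin d} {y z : Fin d → ℤ} {c : ℤ} (hc : c = 0 ∨ c = vUp lo hi y κ) (hz : z κ = lo κ - 1 + c) :
    Frozen lo hi κ z := by
  rcases hc with rfl | rfl
  · exact Or.inl (by rw [hz]; ring)
  · by_cases hup : y κ = hi κ + 1
    · exact Or.inr (by rw [hz, vUp_of_up hup]; ring)
    · exact Or.inl (by rw [hz, vUp_of_not_up hup]; ring)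

omit [GaugeGroup G] in
/-- `restrict ks v κ ∈ {0, v κ}`. [folklore] -/
private theorem restrict_apply_eq_zero_or (ks : List (Fin d)) (v : Fin d → ℤ) (κ : Fin d) :
    restrict ks v κ = 0 ∨ restrict ks v κ = v κ := by
  by_cases h : κ ∈ ks
  · exact Or.inr (restrict_apply_of_mem h v)
  · exact Or.inl (restrict_apply_of_not_mem h v)

omit [GaugeGroup G] in
/-- `restrict ks v κ = 0` when `v κ = 0`. [folklore] -/
private theorem restrict_apply_eq_zero_of {ks : List (Fin d)} {v : Fin d → ℤ} {κ : Fin d} (h : v κ = 0) :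
    restrict ks v κ = 0 := by
  rcases restrict_apply_eq_zero_or ks v κ with h' | h'
  · exact h'
  · rw [h', h]

omit [GaugeGroup G] in
/-- SPLITTING THE LIST OF DIRECTIONS AT `μ`: `[0, …, d−1] = F₁ ++ μ :: F₂` with the bookkeeping facts. [folklore] -/
private theorem split_at (μ : Fin d) : ∃ F₁ F₂ : List (Fin d), List.finRange d = F₁ ++ μ :: F₂ ∧ μ ∉ F₁ ∧ μ ∉ F₂ ∧
    F₁.Nodup ∧ F₂.Nodup ∧ (∀ κ ∈ F₁, κ ∉ F₂) ∧ F₁.length + F₂.length + 1 = d := by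
  obtain ⟨F₁, F₂, h⟩ := List.append_of_mem (List.mem_finRange μ)
  have hnd : (F₁ ++ μ :: F₂).Nodup := h ▸ List.nodup_finRange d
  have hlen : (F₁ ++ μ :: F₂).length = d := by rw [← h, List.length_finRange]
  rw [List.nodup_middle, List.nodup_cons, List.mem_append, not_or] at hnd
  obtain ⟨⟨h1, h2⟩, h12⟩ := hnd
  refine ⟨F₁, F₂, h, h1, h2, h12.sublist (List.sublist_append_left F₁ F₂),
    h12.sublist (List.sublist_append_right F₁ F₂), fun κ hκ hκ' => List.disjoint_of_nodup_append h12 hκ hκ', ?_⟩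
  simp only [List.length_append, List.length_cons] at hlen
  omega

/-- **THE LADDER IDENTITY** behind case A (`y_μ < hi_μ`): for paths `Γ_y = Q ++ W` and `Γ_{y + e_μ} = Q ++ [+e_μ] ++ W`,
`g(y) V(y, μ) g(y + e_μ)⁻¹ = V(Q) · V(ladder of W) · V(Q)⁻¹`. (step of the proof of the p. 193 surface-gauge bound) [cite: Balaban1989LargeFieldI, p.193] -/
theorem conj_ladder_identity (V : (Fin d → ℤ) → Fin d → G) (x y : Fin d → ℤ) (Q W : List (Letter d)) (μ : Fin d)
    (hy : x + disp (Q ++ W) = y) :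
    hol V x (Q ++ W) * V y μ * (hol V x (Q ++ (μ, true) :: W))⁻¹ =
      hol V x Q * hol V (x + disp Q) (ladder W μ) * (hol V x Q)⁻¹ := by
  subst hy
  rw [hol_append, hol_append, hol_cons, stepHol_true, hol_ladder, disp_append, ← add_assoc, Letter.vec_true]
  group

/-- **THE RECTANGLE IDENTITY** behind case B (`y_μ = hi_μ`): moving a full segment `[+e_μ]^N` forward past the block `X`
costs the rectangle of `X`: `V(A X S W)·V(A S X W)⁻¹ = V(A)·thick(X)·V(A)⁻¹`. (step of the proof of the p. 193 surface-gauge bound) [cite: Balaban1989LargeFieldI, p.193] -/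
theorem swap_identity (V : (Fin d → ℤ) → Fin d → G) (x : Fin d → ℤ) (A X W : List (Letter d)) (μ : Fin d) (N : ℕ) :
    hol V x (A ++ X ++ seg μ N ++ W) * (hol V x (A ++ seg μ N ++ X ++ W))⁻¹ =
      hol V x A * thick V (x + disp A) X μ N * (hol V x A)⁻¹ := by
  simp only [hol_append, disp_append, disp_seg, thick, ← add_assoc]
  rw [add_right_comm (x + disp A) ((N : ℤ) • e μ) (disp X)]
  group

/-- The two identities combined: with `Γ_y = A X [+e_μ]^m W` and `Γ_{y+e_μ} = A [+e_μ]^{m+1} X W`,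
`g(y) V(y, μ) g(y + e_μ)⁻¹ = (conjugated ladder of W) · (conjugated rectangle of X)`. (step of the proof of the p. 193 surface-gauge bound) [cite: Balaban1989LargeFieldI, p.193] -/
theorem caseB_identity (V : (Fin d → ℤ) → Fin d → G) (x y : Fin d → ℤ) (A X W : List (Letter d)) (μ : Fin d) (m : ℕ)
    (hy : x + disp (A ++ X ++ seg μ m ++ W) = y) :
    hol V x (A ++ X ++ seg μ m ++ W) * V y μ * (hol V x (A ++ seg μ ((m + 1 : ℕ) : ℤ) ++ X ++ W))⁻¹ =
      (hol V x (A ++ X ++ seg μ m) * hol V (x + disp (A ++ X ++ seg μ m)) (ladder W μ) *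
          (hol V x (A ++ X ++ seg μ m))⁻¹) *
        (hol V x A * thick V (x + disp A) X μ (m + 1) * (hol V x A)⁻¹) := by
  have h1 := conj_ladder_identity V x y (A ++ X ++ seg μ m) W μ hy
  have h3 : A ++ X ++ seg μ (m : ℤ) ++ (μ, true) :: W = A ++ X ++ seg μ ((m + 1 : ℕ) : ℤ) ++ W := by
    rw [Nat.cast_succ, seg_add_one_of_nonneg μ (Int.natCast_nonneg m)]
    simp only [List.append_assoc, List.singleton_append]
  rw [h3, mul_inv_eq_iff_eq_mul] at h1
  rw [h1, mul_assoc, swap_identity V x A X W μ (m + 1)]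

/-- **CASE A OF THE SHELL-BOND BOUND** (`y_μ < hi_μ`: the bond `⟨y, y + e_μ⟩` lies along the lower sweep of `μ`): in the
shell gauge `|V^g(⟨y, y + e_μ⟩) − 1| ≤ d(n + 2)ε` — the value is conjugate to the ladder over the tail `W` of the path (the
coordinates after `μ`), at most `d(n + 2)` plaquettes each with the frozen witness `κ₀`. [cite: Balaban1989LargeFieldI, p.193] -/
theorem dist1_shellAct_le_of_lt {V : (Fin d → ℤ) → Fin d → G} {ε : ℝ} (hV : ShellPlaqSmall V lo hi ε) (hε : 0 ≤ ε)
    (hlohi : lo ≤ hi) {n : ℕ} (hn : ∀ κ, hi κ ≤ lo κ + n) {y : Fin d → ℤ} {μ : Fin d} (hy : lo - 1 ≤ y)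
    (hy' : y ≤ hi + 1) (hlt : y μ < hi μ) {κ₀ : Fin d} (h0μ : κ₀ ≠ μ) (hκ₀ : Frozen lo hi κ₀ y) :
    dist1 (gaugeAct (shellFn V lo hi) V y μ) ≤ d * (n + 2) * ε := by
  obtain ⟨F₁, F₂, hF, hμ1, hμ2, -, hnd2, -, hlen⟩ := split_at μ
  have hup : ¬ y μ = hi μ + 1 := by omega
  have hup' : ¬ (y + e μ) μ = hi μ + 1 := by rw [Pi.add_apply, e_apply, if_pos rfl]; omega
  have hu' : vUp lo hi (y + e μ) = vUp lo hi y := by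
    funext κ
    by_cases hκ : κ = μ
    · rw [hκ, vUp_of_not_up hup', vUp_of_not_up hup]
    · exact vUp_add_e_of_ne hκ
  have hwμ : vLo lo hi (y + e μ) μ = vLo lo hi y μ + 1 := by
    rw [vLo_of_not_up hup', vLo_of_not_up hup, Pi.add_apply, e_apply, if_pos rfl]; ring
  have hW1 : tw F₁ (vLo lo hi (y + e μ)) = tw F₁ (vLo lo hi y) :=
    tw_congr fun κ hκ => vLo_add_e_of_ne fun h => hμ1 (h ▸ hκ)
  have hW2 : tw F₂ (vLo lo hi (y + e μ)) = tw F₂ (vLo lo hi y) :=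
    tw_congr fun κ hκ => vLo_add_e_of_ne fun h => hμ2 (h ▸ hκ)
  obtain ⟨m, hm⟩ := Int.eq_ofNat_of_zero_le (vLo_nonneg (hi := hi) hy μ)
  -- the two paths: `Γ_y = Q ++ W`, `Γ_{y+e_μ} = Q ++ [+e_μ] ++ W`
  have hPy : pathWord lo hi y =
      tw (List.finRange d) (vUp lo hi y) ++ tw F₁ (vLo lo hi y) ++ seg μ (m : ℤ) ++ tw F₂ (vLo lo hi y) := by
    rw [pathWord, tw_split hF (vLo lo hi y), hm]; simp only [List.append_assoc]
  have hPy' : pathWord lo hi (y + e μ) =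
      tw (List.finRange d) (vUp lo hi y) ++ tw F₁ (vLo lo hi y) ++ seg μ (m : ℤ) ++ (μ, true) :: tw F₂ (vLo lo hi y) := by
    rw [pathWord, hu', tw_split hF (vLo lo hi (y + e μ)), hW1, hW2, hwμ, hm, seg_add_one_of_nonneg μ (Int.natCast_nonneg m)]
    simp only [List.append_assoc, List.singleton_append]
  have hyQ : lo - 1 + disp (tw (List.finRange d) (vUp lo hi y) ++ tw F₁ (vLo lo hi y) ++ seg μ (m : ℤ) ++
      tw F₂ (vLo lo hi y)) = y := by
    rw [← hPy]; exact bot_add_disp_pathWord lo hi y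
  unfold gaugeAct shellFn
  rw [hPy, hPy', conj_ladder_identity V (lo - 1) y _ _ μ hyQ, GaugeGroup.dist1_conj]
  -- the witness `κ₀` is frozen at the base of the ladder
  have hbase : Frozen lo hi κ₀ (lo - 1 + disp (tw (List.finRange d) (vUp lo hi y) ++ tw F₁ (vLo lo hi y) ++
      seg μ (m : ℤ))) := by
    rw [disp_append, ← add_assoc] at hyQ
    refine hκ₀.of_apply_eq ?_
    rw [eq_sub_of_add_eq hyQ, Pi.sub_apply, disp_tw hnd2, restrict_apply_eq_zero_of (vLo_eq_zero_of_frozen hκ₀),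
      sub_zero]
  calc dist1 (hol V (lo - 1 + disp (tw (List.finRange d) (vUp lo hi y) ++ tw F₁ (vLo lo hi y) ++ seg μ (m : ℤ)))
        (ladder (tw F₂ (vLo lo hi y)) μ))
      ≤ (tw F₂ (vLo lo hi y)).length * ε :=
        dist1_ladder_tw_le hV hε h0μ F₂ (vLo lo hi y) _ (fun κ hκ h => hμ2 (h ▸ hκ)) (fun κ _ => vLo_nonneg hy κ)
          (fun κ _ h => h ▸ vLo_eq_zero_of_frozen hκ₀) hbase
    _ ≤ d * (n + 2) * ε :=
        length_tw_mul_le (by omega)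
          (fun κ _ => by have h0 := vLo_nonneg (hi := hi) hy κ; have h1 := vLo_le hlohi hy' κ; have h2 := hn κ; omega) hε

/-- **CASE B OF THE SHELL-BOND BOUND** (`y_μ = hi_μ`: the bond climbs onto the upper face `μ`, which becomes an upper
coordinate of `y + e_μ` and is swept FIRST among the coordinates after it): `|V^g(⟨y, y + e_μ⟩) − 1| ≤ 3d(n + 2)²ε` — a
conjugated ladder over the tail `W` (≤ `d(n + 2)ε`) times a conjugated rectangle of height `hi_μ − lo_μ + 2 ≤ n + 2` over the
block `X` (upper sweeps after `μ`, fully frozen base, `d ≥ 3`; then lower moves before `μ`, witness `κ₁`), `≤ 2d(n + 2)²ε`.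
[cite: Balaban1989LargeFieldI, p.193] -/
theorem dist1_shellAct_le_of_eq {V : (Fin d → ℤ) → Fin d → G} {ε : ℝ} (hV : ShellPlaqSmall V lo hi ε) (hε : 0 ≤ ε)
    (hd : 3 ≤ d) (hlohi : lo ≤ hi) {n : ℕ} (hn : ∀ κ, hi κ ≤ lo κ + n) {y : Fin d → ℤ} {μ : Fin d} (hy : lo - 1 ≤ y)
    (hy' : y ≤ hi + 1) (heq : y μ = hi μ) {κ₁ : Fin d} (h1μ : κ₁ ≠ μ) (hκ₁ : Frozen lo hi κ₁ y) :
    dist1 (gaugeAct (shellFn V lo hi) V y μ) ≤ 3 * d * (n + 2) ^ 2 * ε := by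
  obtain ⟨F₁, F₂, hF, hμ1, hμ2, hnd1, hnd2, hdisj, hlen⟩ := split_at μ
  have hup : ¬ y μ = hi μ + 1 := by omega
  have hup' : (y + e μ) μ = hi μ + 1 := by rw [Pi.add_apply, e_apply, if_pos rfl, heq]
  obtain ⟨m, hm⟩ := Int.eq_ofNat_of_zero_le (vLo_nonneg (hi := hi) hy μ)
  have hm' : (m : ℤ) = hi μ - lo μ + 1 := by rw [← hm, vLo_of_not_up hup, heq]; ring
  have huμ : vUp lo hi y μ = 0 := vUp_of_not_up hup
  have hu'μ : vUp lo hi (y + e μ) μ = ((m + 1 : ℕ) : ℤ) := by rw [vUp_of_up hup']; push_cast; linarith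
  have hw'μ : vLo lo hi (y + e μ) μ = 0 := vLo_of_up hup'
  have hU1 : tw F₁ (vUp lo hi (y + e μ)) = tw F₁ (vUp lo hi y) :=
    tw_congr fun κ hκ => vUp_add_e_of_ne fun h => hμ1 (h ▸ hκ)
  have hU2 : tw F₂ (vUp lo hi (y + e μ)) = tw F₂ (vUp lo hi y) :=
    tw_congr fun κ hκ => vUp_add_e_of_ne fun h => hμ2 (h ▸ hκ)
  have hW1 : tw F₁ (vLo lo hi (y + e μ)) = tw F₁ (vLo lo hi y) :=
    tw_congr fun κ hκ => vLo_add_e_of_ne fun h => hμ1 (h ▸ hκ)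
  have hW2 : tw F₂ (vLo lo hi (y + e μ)) = tw F₂ (vLo lo hi y) :=
    tw_congr fun κ hκ => vLo_add_e_of_ne fun h => hμ2 (h ▸ hκ)
  -- the two paths: `Γ_y = A X [+e_μ]^m W`, `Γ_{y+e_μ} = A [+e_μ]^{m+1} X W`
  have hPy : pathWord lo hi y = tw F₁ (vUp lo hi y) ++ (tw F₂ (vUp lo hi y) ++ tw F₁ (vLo lo hi y)) ++ seg μ (m : ℤ) ++
      tw F₂ (vLo lo hi y) := by
    rw [pathWord, tw_split hF (vUp lo hi y), tw_split hF (vLo lo hi y), huμ, seg_zero, List.append_nil, hm]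
    simp only [List.append_assoc]
  have hPy' : pathWord lo hi (y + e μ) = tw F₁ (vUp lo hi y) ++ seg μ ((m + 1 : ℕ) : ℤ) ++
      (tw F₂ (vUp lo hi y) ++ tw F₁ (vLo lo hi y)) ++ tw F₂ (vLo lo hi y) := by
    rw [pathWord, tw_split hF (vUp lo hi (y + e μ)), tw_split hF (vLo lo hi (y + e μ)), hU1, hU2, hW1, hW2, hu'μ, hw'μ,
      seg_zero, List.append_nil]
    simp only [List.append_assoc]
  have hyQ : lo - 1 + disp (tw F₁ (vUp lo hi y) ++ (tw F₂ (vUp lo hi y) ++ tw F₁ (vLo lo hi y)) ++ seg μ (m : ℤ) ++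
      tw F₂ (vLo lo hi y)) = y := by
    rw [← hPy]; exact bot_add_disp_pathWord lo hi y
  unfold gaugeAct shellFn
  rw [hPy, hPy', caseB_identity V (lo - 1) y _ _ _ μ m hyQ]
  refine (GaugeGroup.dist1_mul_le _ _).trans ?_
  rw [GaugeGroup.dist1_conj, GaugeGroup.dist1_conj]
  -- (1) the ladder over the tail `W = tw F₂ vLo`, witness `κ₁`
  have hbase : Frozen lo hi κ₁ (lo - 1 + disp (tw F₁ (vUp lo hi y) ++ (tw F₂ (vUp lo hi y) ++ tw F₁ (vLo lo hi y)) ++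
      seg μ (m : ℤ))) := by
    rw [disp_append, ← add_assoc] at hyQ
    refine hκ₁.of_apply_eq ?_
    rw [eq_sub_of_add_eq hyQ, Pi.sub_apply, disp_tw hnd2, restrict_apply_eq_zero_of (vLo_eq_zero_of_frozen hκ₁),
      sub_zero]
  have hL : dist1 (hol V (lo - 1 + disp (tw F₁ (vUp lo hi y) ++ (tw F₂ (vUp lo hi y) ++ tw F₁ (vLo lo hi y)) ++
      seg μ (m : ℤ))) (ladder (tw F₂ (vLo lo hi y)) μ)) ≤ d * (n + 2) * ε :=
    calc dist1 (hol V (lo - 1 + disp (tw F₁ (vUp lo hi y) ++ (tw F₂ (vUp lo hi y) ++ tw F₁ (vLo lo hi y)) ++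
          seg μ (m : ℤ))) (ladder (tw F₂ (vLo lo hi y)) μ))
        ≤ (tw F₂ (vLo lo hi y)).length * ε :=
          dist1_ladder_tw_le hV hε h1μ F₂ (vLo lo hi y) _ (fun κ hκ h => hμ2 (h ▸ hκ)) (fun κ _ => vLo_nonneg hy κ)
            (fun κ _ h => h ▸ vLo_eq_zero_of_frozen hκ₁) hbase
      _ ≤ d * (n + 2) * ε :=
          length_tw_mul_le (by omega)
            (fun κ _ => by have h0 := vLo_nonneg (hi := hi) hy κ; have h1 := vLo_le hlohi hy' κ; have h2 := hn κ; omega) hε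
  -- (2) the rectangle over the upper sweeps `tw F₂ vUp` from the fully frozen base `a = (lo − 1) + restrict F₁ vUp`
  have hA : ∀ ν, Frozen lo hi ν (lo - 1 + disp (tw F₁ (vUp lo hi y))) := fun ν =>
    frozen_of_eq (restrict_apply_eq_zero_or F₁ (vUp lo hi y) ν)
      (by rw [Pi.add_apply, Pi.sub_apply, Pi.one_apply, disp_tw hnd1])
  have hT1 : dist1 (thick V (lo - 1 + disp (tw F₁ (vUp lo hi y))) (tw F₂ (vUp lo hi y)) μ (m + 1)) ≤
      (m + 1 : ℕ) * ((tw F₂ (vUp lo hi y)).length * ε) := by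
    refine dist1_thick_tw_le_full hV hε hd hlohi (m + 1) F₂ (vUp lo hi y) _ (fun κ hκ h => hμ2 (h ▸ hκ)) hnd2
      (fun κ hκ => ?_) (fun ν _ => hA ν)
    by_cases hupκ : y κ = hi κ + 1
    · refine Or.inr ⟨vUp_of_up hupκ, ?_⟩
      rw [Pi.add_apply, Pi.sub_apply, Pi.one_apply, disp_tw hnd1, restrict_apply_of_not_mem (fun h => hdisj κ h hκ),
        add_zero]
    · exact Or.inl (vUp_of_not_up hupκ)
  -- (3) the rectangle over the lower moves `tw F₁ vLo` (coordinates before `μ`), witness `κ₁`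
  have hA2 : Frozen lo hi κ₁ (lo - 1 + disp (tw F₁ (vUp lo hi y)) + disp (tw F₂ (vUp lo hi y))) := by
    by_cases h1 : κ₁ ∈ F₁
    · refine frozen_of_eq (restrict_apply_eq_zero_or F₁ (vUp lo hi y) κ₁) ?_
      rw [Pi.add_apply, Pi.add_apply, Pi.sub_apply, Pi.one_apply, disp_tw hnd1, disp_tw hnd2,
        restrict_apply_of_not_mem (hdisj κ₁ h1), add_zero]
    · refine frozen_of_eq (restrict_apply_eq_zero_or F₂ (vUp lo hi y) κ₁) ?_
      rw [Pi.add_apply, Pi.add_apply, Pi.sub_apply, Pi.one_apply, disp_tw hnd1, disp_tw hnd2,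
        restrict_apply_of_not_mem h1, add_zero]
  have hT2 : dist1 (thick V (lo - 1 + disp (tw F₁ (vUp lo hi y)) + disp (tw F₂ (vUp lo hi y))) (tw F₁ (vLo lo hi y)) μ
      (m + 1)) ≤ (m + 1 : ℕ) * ((tw F₁ (vLo lo hi y)).length * ε) :=
    dist1_thick_tw_le hV hε h1μ (m + 1) F₁ (vLo lo hi y) _ (fun κ hκ h => hμ1 (h ▸ hκ)) (fun κ _ => vLo_nonneg hy κ)
      (fun κ _ h => h ▸ vLo_eq_zero_of_frozen hκ₁) hA2
  have hT := (dist1_thick_append_le V (lo - 1 + disp (tw F₁ (vUp lo hi y))) (tw F₂ (vUp lo hi y)) (tw F₁ (vLo lo hi y)) μ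
    (m + 1)).trans (add_le_add hT2 hT1)
  -- bookkeeping of the constants
  have hB1 : ((tw F₁ (vLo lo hi y)).length : ℝ) * ε ≤ d * (n + 2) * ε :=
    length_tw_mul_le (by omega)
      (fun κ _ => by have h0 := vLo_nonneg (hi := hi) hy κ; have h1 := vLo_le hlohi hy' κ; have h2 := hn κ; omega) hε
  have hB2 : ((tw F₂ (vUp lo hi y)).length : ℝ) * ε ≤ d * (n + 2) * ε :=
    length_tw_mul_le (by omega)
      (fun κ _ => by have h0 := vUp_nonneg hlohi y κ; have h1 := vUp_le hlohi y κ; have h2 := hn κ; omega) hε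
  have hmn : m + 1 ≤ n + 2 := by have := hn μ; omega
  have hmnR : ((m + 1 : ℕ) : ℝ) ≤ (n : ℝ) + 2 := by exact_mod_cast hmn
  have h0 : (0 : ℝ) ≤ d * (n + 2) * ε := by positivity
  have hT' : dist1 (thick V (lo - 1 + disp (tw F₁ (vUp lo hi y))) (tw F₂ (vUp lo hi y) ++ tw F₁ (vLo lo hi y)) μ
      (m + 1)) ≤ ((n : ℝ) + 2) * (d * (n + 2) * ε) + ((n : ℝ) + 2) * (d * (n + 2) * ε) :=
    hT.trans (add_le_add (mul_le_mul hmnR hB1 (by positivity) (by positivity))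
      (mul_le_mul hmnR hB2 (by positivity) (by positivity)))
  refine (add_le_add hL hT').trans ?_
  nlinarith [mul_nonneg h0 (n.cast_nonneg : (0 : ℝ) ≤ n)]

/-- **THE SHELL-BOND BOUND ON `ℤ^d`** (*"|V′_k(b′) − 1| < O(1)M²ε"*, p. 193, here for EVERY bond of the shell
`[lo − 1, hi + 1] \ [lo, hi]`, `d ≥ 3`): if the plaquettes with a frozen coordinate are `ε`-small, then in the shell gauge
every bond `⟨y, y + e_μ⟩` of the big box with both ends in the shell has `|V^g(b) − 1| ≤ 3d(n + 2)²ε` (`n + 1` ≥ the number of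
sites of `Λ` per direction). [cite: Balaban1989LargeFieldI, p.193] -/
theorem dist1_shellAct_le {V : (Fin d → ℤ) → Fin d → G} {ε : ℝ} (hV : ShellPlaqSmall V lo hi ε) (hε : 0 ≤ ε)
    (hd : 3 ≤ d) (hlohi : lo ≤ hi) {n : ℕ} (hn : ∀ κ, hi κ ≤ lo κ + n) {y : Fin d → ℤ} {μ : Fin d} (hy : lo - 1 ≤ y)
    (hyμ : y + e μ ≤ hi + 1) (hyS : ∃ κ₀, Frozen lo hi κ₀ y) (hyS' : ∃ κ₀, Frozen lo hi κ₀ (y + e μ)) :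
    dist1 (gaugeAct (shellFn V lo hi) V y μ) ≤ 3 * d * (n + 2) ^ 2 * ε := by
  have hy' : y ≤ hi + 1 := (le_add_of_nonneg_right (e_nonneg μ)).trans hyμ
  have hyμ' : y μ ≤ hi μ := by
    have := hyμ μ
    rw [Pi.add_apply, Pi.add_apply, e_apply, if_pos rfl, Pi.one_apply] at this
    linarith
  rcases hyμ'.lt_or_eq with hlt | heq
  · obtain ⟨κ₀, hκ₀⟩ := hyS'
    have h0μ : κ₀ ≠ μ := by
      intro h
      rw [h] at hκ₀
      have h1 : (lo - 1) μ ≤ y μ := hy μ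
      rw [Pi.sub_apply, Pi.one_apply] at h1
      unfold Frozen at hκ₀
      rw [Pi.add_apply, e_apply, if_pos rfl] at hκ₀
      omega
    have hκ₀y : Frozen lo hi κ₀ y := hκ₀.of_apply_eq (by rw [Pi.add_apply, e_apply, if_neg h0μ, add_zero])
    refine (dist1_shellAct_le_of_lt hV hε hlohi hn hy hy' hlt h0μ hκ₀y).trans ?_
    have h0 : (0 : ℝ) ≤ d * (n + 2) * ε := by positivity
    nlinarith [mul_nonneg h0 (by positivity : (0 : ℝ) ≤ 3 * n + 5)]
  · obtain ⟨κ₁, hκ₁⟩ := hyS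
    have h1μ : κ₁ ≠ μ := by
      intro h
      rw [h] at hκ₁
      have h3 : lo μ ≤ hi μ := hlohi μ
      unfold Frozen at hκ₁
      omega
    exact dist1_shellAct_le_of_eq hV hε hd hlohi hn hy hy' heq h1μ hκ₁

end ShellPath

/-! ## §C  Transport to the torus: the shell gauge of a parallelepiped `Λ` and the extension lemma with ALL plaquettes regular -/

section Torus

variable {P : Params} {k : ℕ} {G : Type*} [GaugeGroup G] {lo hi : Fin P.d → ℤ}

open T4AxialGaugeSmallField (castSite castSite_apply castSite_add_e pull pull_apply hol_pull_plaqWord_of_lt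
  hol_pull_plaqWord_of_gt)
open B15Extension193 (boxSites Touches outBonds corners outPlaqs mem_corners_iff primed extend primed_of_touches
  primed_of_mem_outBonds mem_outBonds_iff_not_touches extend_eq_of_mem_outBonds dist1_plaqHol_extend
  plaqHol_extend_of_mem_outPlaqs castSite_inj_big corner_plaq_mem_outPlaqs)

/-- **WHY NO INJECTIVITY IS NEEDED FOR THE PLAQUETTE HYPOTHESIS**: a point of `ℤ^d` with a frozen coordinate `κ₀`
(`= lo κ₀ − 1` or `hi κ₀ + 1`) projects OFF `Λ = boxSites lo hi`, whatever its other coordinates — the `κ₀`-coordinates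
differ by a non-zero amount `< sitesPerDir` (margin `hi − lo + 3 < sitesPerDir`). [cite: Balaban1989LargeFieldI, p.193] -/
theorem castSite_not_mem_boxSites_of_frozen (hlohi : lo ≤ hi) (hN : ∀ κ, hi κ - lo κ + 3 < (P.sitesPerDir k : ℤ))
    {w : Fin P.d → ℤ} {κ₀ : Fin P.d} (hw : Frozen lo hi κ₀ w) : (castSite w : Site P k) ∉ boxSites lo hi := by
  rintro ⟨x, hx, hx', hxw⟩
  have hκ : ((x κ₀ : ℤ) : ZMod (P.sitesPerDir k)) = ((w κ₀ : ℤ) : ZMod (P.sitesPerDir k)) := by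
    have := congr_fun hxw κ₀
    simpa only [castSite_apply] using this
  rw [ZMod.intCast_eq_intCast_iff_dvd_sub] at hκ
  have h1 : lo κ₀ ≤ x κ₀ := hx κ₀
  have h2 : x κ₀ ≤ hi κ₀ := hx' κ₀
  have h3 := hN κ₀
  have h4 : lo κ₀ ≤ hi κ₀ := hlohi κ₀
  unfold Frozen at hw
  have h0 : w κ₀ - x κ₀ = 0 :=
    Int.eq_zero_of_abs_lt_dvd hκ (abs_sub_lt_iff.2 ⟨by rcases hw with h | h <;> omega, by rcases hw with h | h <;> omega⟩)
  rcases hw with h | h <;> omega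

/-- **THE TORUS HYPOTHESIS GIVES THE `ℤ^d` ONE**: `|U(∂p′) − 1| < ε` on the plaquettes of `Λᶜ` (`outPlaqs Λ`: no corner in
`Λ`) implies `ShellPlaqSmall (pull U) lo hi ε` — every corner of a plaquette based at a point with a frozen coordinate
`κ₀ ∉ {κ, ν}` has that coordinate frozen. [cite: Balaban1989LargeFieldI, p.193] -/
theorem shellPlaqSmall_pull (hlohi : lo ≤ hi) (hN : ∀ κ, hi κ - lo κ + 3 < (P.sitesPerDir k : ℤ)) {ε : ℝ}
    {U : GaugeField P k G} (hU : PlaqSmallOn (outPlaqs (boxSites lo hi)) ε U) : ShellPlaqSmall (pull U) lo hi ε := by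
  intro z κ ν κ₀ hκν h0κ h0ν hz
  have hout : ∀ {a b : Fin P.d} (hab : a < b), κ₀ ≠ a → κ₀ ≠ b →
      (⟨castSite z, a, b, hab⟩ : Plaq P k) ∈ outPlaqs (boxSites lo hi) := by
    intro a b hab ha hb c hc
    rw [mem_corners_iff] at hc
    simp only at hc
    rcases hc with rfl | rfl | rfl | rfl
    · exact castSite_not_mem_boxSites_of_frozen hlohi hN hz
    · rw [← castSite_add_e]
      exact castSite_not_mem_boxSites_of_frozen hlohi hN (hz.add_e ha)
    · rw [← castSite_add_e]
      exact castSite_not_mem_boxSites_of_frozen hlohi hN (hz.add_e hb)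
    · rw [← castSite_add_e, ← castSite_add_e]
      exact castSite_not_mem_boxSites_of_frozen hlohi hN ((hz.add_e ha).add_e hb)
  rcases lt_or_gt_of_ne hκν with h | h
  · rw [hol_pull_plaqWord_of_lt U z h]
    exact (hU _ (hout h h0κ h0ν)).le
  · rw [hol_pull_plaqWord_of_gt U z h, GaugeGroup.dist1_inv]
    exact (hU _ (hout h h0ν h0κ)).le

open Classical in
/-- **THE SHELL GAUGE ON THE TORUS**: `shellFn (pull U)` at the image of a point of the big box `[lo − 1, hi + 1]`, `1`
elsewhere (well defined on non-wrapping boxes, `shellGauge_castSite`) — the *generalized axial gauge* of p. 193, on the whole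
shell. [cite: Balaban1989LargeFieldI, p.193] -/
def shellGauge (U : GaugeField P k G) (lo hi : Fin P.d → ℤ) : GaugeTransf P k G := fun s =>
  if h : ∃ x : Fin P.d → ℤ, lo - 1 ≤ x ∧ x ≤ hi + 1 ∧ (castSite x : Site P k) = s then
    shellFn (pull U) lo hi (Classical.choose h) else 1

/-- On the big box the torus gauge transformation IS the `ℤ^d` shell gauge function. [cite: Balaban1989LargeFieldI, p.193] -/
theorem shellGauge_castSite (U : GaugeField P k G) (hN : ∀ κ, hi κ - lo κ + 3 < (P.sitesPerDir k : ℤ))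
    {x : Fin P.d → ℤ} (hx : lo - 1 ≤ x) (hx' : x ≤ hi + 1) :
    shellGauge U lo hi (castSite x) = shellFn (pull U) lo hi x := by
  have h : ∃ x' : Fin P.d → ℤ, lo - 1 ≤ x' ∧ x' ≤ hi + 1 ∧ (castSite x' : Site P k) = castSite x := ⟨x, hx, hx', rfl⟩
  unfold shellGauge
  rw [dif_pos h]
  obtain ⟨h1, h2, h3⟩ := Classical.choose_spec h
  have e1 : ∀ κ, lo κ - 1 ≤ Classical.choose h κ := fun κ => by
    have h1κ : (lo - 1) κ ≤ Classical.choose h κ := h1 κ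
    rwa [Pi.sub_apply, Pi.one_apply] at h1κ
  have e2 : ∀ κ, Classical.choose h κ ≤ hi κ + 2 := fun κ => by
    have h2κ : Classical.choose h κ ≤ (hi + 1) κ := h2 κ
    rw [Pi.add_apply, Pi.one_apply] at h2κ
    linarith
  have e3 : ∀ κ, lo κ - 1 ≤ x κ := fun κ => by
    have hxκ : (lo - 1) κ ≤ x κ := hx κ
    rwa [Pi.sub_apply, Pi.one_apply] at hxκ
  have e4 : ∀ κ, x κ ≤ hi κ + 2 := fun κ => by
    have hxκ : x κ ≤ (hi + 1) κ := hx' κ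
    rw [Pi.add_apply, Pi.one_apply] at hxκ
    linarith
  rw [castSite_inj_big hN e1 e2 e3 e4 h3]

/-- The torus gauge action of `shellGauge` on a bond of the big box is the `ℤ^d` gauge action of `shellFn` on the pullback.
[cite: Balaban1989LargeFieldI, p.193] -/
theorem gaugeAct_shellGauge_castSite (U : GaugeField P k G) (hN : ∀ κ, hi κ - lo κ + 3 < (P.sitesPerDir k : ℤ))
    {x : Fin P.d → ℤ} {μ : Fin P.d} (hx : lo - 1 ≤ x) (hxμ : x + e μ ≤ hi + 1) :
    GaugeField.gaugeAct (shellGauge U lo hi) U ⟨castSite x, μ⟩ = gaugeAct (shellFn (pull U) lo hi) (pull U) x μ := by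
  have hx' : x ≤ hi + 1 := (le_add_of_nonneg_right (e_nonneg μ)).trans hxμ
  have hlo' : lo - 1 ≤ x + e μ := hx.trans (le_add_of_nonneg_right (e_nonneg μ))
  simp only [GaugeField.gaugeAct, PBond.tgt, gaugeAct, pull_apply]
  rw [← castSite_add_e, shellGauge_castSite U hN hx hx', shellGauge_castSite U hN hlo' hxμ]

/-- THE SHELL of `Λ` on the torus: the image of the points of the big box `[lo − 1, hi + 1]` with a frozen coordinate
(`∂⁺Λ` together with the lower-dimensional edges and corners of the big box). [cite: Balaban1989LargeFieldI, p.193] -/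
def shellSites (lo hi : Fin P.d → ℤ) : Set (Site P k) :=
  {s | ∃ x : Fin P.d → ℤ, lo - 1 ≤ x ∧ x ≤ hi + 1 ∧ (∃ κ₀, Frozen lo hi κ₀ x) ∧ castSite x = s}

omit [GaugeGroup G] in
/-- A point of the big box projects into `Λ` or into the shell. [cite: Balaban1989LargeFieldI, p.193] -/
theorem mem_box_or_shell {w : Fin P.d → ℤ} (hw : lo - 1 ≤ w) (hw' : w ≤ hi + 1) :
    (castSite w : Site P k) ∈ boxSites lo hi ∨ (castSite w : Site P k) ∈ shellSites lo hi := by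
  by_cases h : ∀ κ, lo κ ≤ w κ ∧ w κ ≤ hi κ
  · exact Or.inl ⟨w, fun κ => (h κ).1, fun κ => (h κ).2, rfl⟩
  · push Not at h
    obtain ⟨κ₀, hκ₀⟩ := h
    refine Or.inr ⟨w, hw, hw', ⟨κ₀, ?_⟩, rfl⟩
    have h1 : (lo - 1) κ₀ ≤ w κ₀ := hw κ₀
    have h2 : w κ₀ ≤ (hi + 1) κ₀ := hw' κ₀
    rw [Pi.sub_apply, Pi.one_apply] at h1
    rw [Pi.add_apply, Pi.one_apply] at h2
    unfold Frozen
    by_cases h3 : lo κ₀ ≤ w κ₀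
    · have h4 := hκ₀ h3
      omega
    · omega

omit [GaugeGroup G] in
/-- `y ↦ y + e_μ` is injective on the torus. [folklore] -/
private theorem shift_injective (μ : Fin P.d) : Function.Injective fun y : Site P k => y.shift μ := by
  intro y y' h
  funext κ
  have hκ := congr_fun h κ
  simp only [Site.shift, Function.update_apply] at hκ
  by_cases hκμ : κ = μ
  · subst hκμ
    simp only [if_true] at hκ
    exact add_right_cancel hκ
  · simpa [hκμ] using hκ

omit [GaugeGroup G] in
/-- **THE PLAQUETTE DICHOTOMY FOR A PARALLELEPIPED**: a plaquette with a corner in `Λ` has ALL its corners in `Λ ∪ shell` —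
in particular the corner plaquettes of GAPS G-B15-02 (a corner in `Λ`, another outside `Λ ∪ ∂⁺Λ`) have their outside
corners in the shell. [cite: Balaban1989LargeFieldI, p.193] -/
theorem corners_subset_of_not_mem_outPlaqs {p : Plaq P k} (hp : p ∉ outPlaqs (boxSites lo hi)) :
    ∀ c ∈ corners p, c ∈ boxSites lo hi ∨ c ∈ shellSites (k := k) lo hi := by
  simp only [outPlaqs, Set.mem_setOf_eq, not_forall, not_not, exists_prop] at hp
  obtain ⟨c₀, hc₀, x₀, hx₀, hx₀', rfl⟩ := hp
  obtain ⟨src, a, b, hab⟩ := p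
  have hea : ∀ κ, (0 : ℤ) ≤ e a κ ∧ e a κ ≤ 1 := fun κ => by rw [e_apply]; split_ifs <;> simp
  have heb : ∀ κ, (0 : ℤ) ≤ e b κ ∧ e b κ ≤ 1 := fun κ => by rw [e_apply]; split_ifs <;> simp
  have heab : ∀ κ, e a κ + e b κ ≤ (1 : ℤ) := fun κ => by
    have hne : a ≠ b := hab.ne
    rw [e_apply, e_apply]
    split_ifs with h1 h2
    · exact absurd (h1.symm.trans h2) hne
    all_goals simp
  rw [mem_corners_iff] at hc₀
  simp only at hc₀
  -- Step 1: the lower corner of `p` is the image of a point `z` of `ℤ^d` near `x₀`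
  obtain ⟨z, hzsrc, hz, hz'⟩ : ∃ z : Fin P.d → ℤ, (castSite z : Site P k) = src ∧ (∀ κ, lo κ - 1 ≤ z κ) ∧
      ∀ κ, z κ + e a κ + e b κ ≤ hi κ + 1 := by
    rcases hc₀ with h | h | h | h
    · exact ⟨x₀, h, fun κ => by linarith [hx₀ κ], fun κ => by linarith [hx₀' κ, heab κ]⟩
    · refine ⟨x₀ - e a, shift_injective a ?_, fun κ => ?_, fun κ => ?_⟩
      · show (castSite (x₀ - e a) : Site P k).shift a = src.shift a
        rw [← castSite_add_e, sub_add_cancel, h]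
      · simp only [Pi.sub_apply]; linarith [hx₀ κ, (hea κ).2]
      · simp only [Pi.sub_apply]; linarith [hx₀' κ, (heb κ).2]
    · refine ⟨x₀ - e b, shift_injective b ?_, fun κ => ?_, fun κ => ?_⟩
      · show (castSite (x₀ - e b) : Site P k).shift b = src.shift b
        rw [← castSite_add_e, sub_add_cancel, h]
      · simp only [Pi.sub_apply]; linarith [hx₀ κ, (heb κ).2]
      · simp only [Pi.sub_apply]; linarith [hx₀' κ, (hea κ).2]
    · refine ⟨x₀ - e a - e b, shift_injective a (shift_injective b ?_), fun κ => ?_, fun κ => ?_⟩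
      · show ((castSite (x₀ - e a - e b) : Site P k).shift a).shift b = (src.shift a).shift b
        rw [← castSite_add_e, ← castSite_add_e, show x₀ - e a - e b + e a + e b = x₀ by abel, h]
      · simp only [Pi.sub_apply]; linarith [hx₀ κ, heab κ]
      · simp only [Pi.sub_apply]; linarith [hx₀' κ]
  subst hzsrc
  -- Step 2: every corner is the image of a point of the big box
  have hcorner : ∀ w : Fin P.d → ℤ, (∀ κ, z κ ≤ w κ) → (∀ κ, w κ ≤ z κ + e a κ + e b κ) →
      (castSite w : Site P k) ∈ boxSites lo hi ∨ (castSite w : Site P k) ∈ shellSites lo hi := fun w h1 h2 =>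
    mem_box_or_shell (fun κ => by rw [Pi.sub_apply, Pi.one_apply]; linarith [hz κ, h1 κ])
      (fun κ => by rw [Pi.add_apply, Pi.one_apply]; linarith [hz' κ, h2 κ])
  intro c hc
  rw [mem_corners_iff] at hc
  simp only at hc
  rcases hc with rfl | rfl | rfl | rfl
  · exact hcorner z (fun κ => le_rfl) (fun κ => by linarith [(hea κ).1, (heb κ).1])
  · rw [← castSite_add_e]
    exact hcorner _ (fun κ => by rw [Pi.add_apply]; linarith [(hea κ).1])
      (fun κ => by rw [Pi.add_apply]; linarith [(heb κ).1])
  · rw [← castSite_add_e]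
    exact hcorner _ (fun κ => by rw [Pi.add_apply]; linarith [(heb κ).1])
      (fun κ => by rw [Pi.add_apply]; linarith [(hea κ).1])
  · rw [← castSite_add_e, ← castSite_add_e]
    exact hcorner _ (fun κ => by rw [Pi.add_apply, Pi.add_apply]; linarith [(hea κ).1, (heb κ).1])
      (fun κ => by rw [Pi.add_apply, Pi.add_apply])

/-- `V′` ON A PLAQUETTE WITH CORNERS IN `Λ ∪ T` (general `Λ`, any set `T` carrying the gauge bound): each of its bonds is
either «in Λ» (`V′ = 1`) or has both ends in `T` (`V′ = V^g`, within `δ′`). [cite: Balaban1989LargeFieldI, p.193] -/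
theorem dist1_primed_le_of_corners {Λ T : Set (Site P k)} (g : GaugeTransf P k G) (V : GaugeField P k G) {δ' : ℝ}
    (hδ' : 0 ≤ δ') (hT : ∀ b : PBond P k, b.src ∈ T → b.tgt ∈ T → dist1 (GaugeField.gaugeAct g V b) ≤ δ')
    {p : Plaq P k} (hp : ∀ c ∈ corners p, c ∈ Λ ∨ c ∈ T) {b : PBond P k} (hsrc : b.src ∈ corners p)
    (htgt : b.tgt ∈ corners p) : dist1 (primed Λ g V b) ≤ δ' := by
  by_cases hb : Touches Λ b
  · rw [primed_of_touches g V hb, GaugeGroup.dist1_one]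
    exact hδ'
  · have hout : b ∈ outBonds Λ := (mem_outBonds_iff_not_touches b).2 hb
    rw [primed_of_mem_outBonds g V hout]
    exact hT b ((hp _ hsrc).resolve_left hout.1) ((hp _ htgt).resolve_left hout.2)

/-- **THE REGULARITY TRANSFER, corner-set form** (general `Λ`): if `|V^g(b) − 1| ≤ δ′` on the bonds with both ends in `T`,
the extension `V̂ = extend Λ g V` has `|V̂(∂p) − 1| ≤ 4δ′` on every plaquette with all corners in `Λ ∪ T`
(`B15Extension193.dist1_plaqHol_extend_le` is the case `T = ∂⁺Λ`). [cite: Balaban1989LargeFieldI, p.193] -/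
theorem dist1_plaqHol_extend_le_of_corners {Λ T : Set (Site P k)} (g : GaugeTransf P k G) (V : GaugeField P k G)
    {δ' : ℝ} (hδ' : 0 ≤ δ') (hT : ∀ b : PBond P k, b.src ∈ T → b.tgt ∈ T → dist1 (GaugeField.gaugeAct g V b) ≤ δ')
    {p : Plaq P k} (hp : ∀ c ∈ corners p, c ∈ Λ ∨ c ∈ T) :
    dist1 (GaugeField.plaqHol (extend Λ g V) p) ≤ 4 * δ' := by
  rw [dist1_plaqHol_extend]
  set W := primed Λ g V with hW
  have c1 : p.src ∈ corners p := (mem_corners_iff p _).2 (Or.inl rfl)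
  have c2 : p.src.shift p.μ ∈ corners p := (mem_corners_iff p _).2 (Or.inr (Or.inl rfl))
  have c3 : p.src.shift p.ν ∈ corners p := (mem_corners_iff p _).2 (Or.inr (Or.inr (Or.inl rfl)))
  have c4 : (p.src.shift p.μ).shift p.ν ∈ corners p := (mem_corners_iff p _).2 (Or.inr (Or.inr (Or.inr rfl)))
  have c4' : (p.src.shift p.ν).shift p.μ ∈ corners p := by rw [← Site.shift_comm]; exact c4
  have hb1 : dist1 (W ⟨p.src, p.μ⟩) ≤ δ' := dist1_primed_le_of_corners g V hδ' hT hp (b := ⟨p.src, p.μ⟩) c1 c2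
  have hb2 : dist1 (W ⟨p.src.shift p.μ, p.ν⟩) ≤ δ' :=
    dist1_primed_le_of_corners g V hδ' hT hp (b := ⟨p.src.shift p.μ, p.ν⟩) c2 c4
  have hb3 : dist1 (W ⟨p.src.shift p.ν, p.μ⟩) ≤ δ' :=
    dist1_primed_le_of_corners g V hδ' hT hp (b := ⟨p.src.shift p.ν, p.μ⟩) c3 c4'
  have hb4 : dist1 (W ⟨p.src, p.ν⟩) ≤ δ' := dist1_primed_le_of_corners g V hδ' hT hp (b := ⟨p.src, p.ν⟩) c1 c3
  unfold GaugeField.plaqHol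
  have h₁ := GaugeGroup.dist1_mul_le (W ⟨p.src, p.μ⟩ * W ⟨p.src.shift p.μ, p.ν⟩ * (W ⟨p.src.shift p.ν, p.μ⟩)⁻¹)
    (W ⟨p.src, p.ν⟩)⁻¹
  have h₂ := GaugeGroup.dist1_mul_le (W ⟨p.src, p.μ⟩ * W ⟨p.src.shift p.μ, p.ν⟩) (W ⟨p.src.shift p.ν, p.μ⟩)⁻¹
  have h₃ := GaugeGroup.dist1_mul_le (W ⟨p.src, p.μ⟩) (W ⟨p.src.shift p.μ, p.ν⟩)
  rw [GaugeGroup.dist1_inv] at h₁ h₂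
  linarith

/-- **THE SHELL-GAUGE BOUND ON THE TORUS** (*"|V′_k(b′) − 1| < O(1)M²ε"*, p. 193, for every bond with both ends in the
shell of a parallelepiped, `d ≥ 3`, PROVED with `O(1)M² ↤ 3d(n + 2)²`): the pullback argument `dist1_shellAct_le` read
through `gaugeAct_shellGauge_castSite`. [cite: Balaban1989LargeFieldI, p.193] -/
theorem dist1_gaugeAct_shellGauge_le (hd : 3 ≤ P.d) (hlohi : lo ≤ hi) {n : ℕ} (hn : ∀ κ, hi κ ≤ lo κ + n)
    (hN : ∀ κ, hi κ - lo κ + 3 < (P.sitesPerDir k : ℤ)) {ε : ℝ} (hε : 0 ≤ ε) {U : GaugeField P k G}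
    (hU : PlaqSmallOn (outPlaqs (boxSites lo hi)) ε U) {b : PBond P k} (hs : b.src ∈ shellSites lo hi)
    (ht : b.tgt ∈ shellSites lo hi) :
    dist1 (GaugeField.gaugeAct (shellGauge U lo hi) U b) ≤ 3 * P.d * (n + 2) ^ 2 * ε := by
  obtain ⟨x, hx, hx', ⟨κ₀, hκ₀⟩, hsrc⟩ := hs
  obtain ⟨x', hy, hy', ⟨κ₁, hκ₁⟩, htgt⟩ := ht
  obtain ⟨src, dir⟩ := b
  simp only at hsrc
  subst hsrc
  have htgt' : (castSite x' : Site P k) = castSite (x + e dir) := by rw [castSite_add_e]; exact htgt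
  have e1 : ∀ κ, lo κ - 1 ≤ x' κ := fun κ => by
    have h := hy κ; rwa [Pi.sub_apply, Pi.one_apply] at h
  have e2 : ∀ κ, x' κ ≤ hi κ + 2 := fun κ => by
    have h : x' κ ≤ (hi + 1) κ := hy' κ
    rw [Pi.add_apply, Pi.one_apply] at h
    linarith
  have e3 : ∀ κ, lo κ - 1 ≤ (x + e dir) κ := fun κ => by
    have h : (lo - 1) κ ≤ x κ := hx κ
    rw [Pi.sub_apply, Pi.one_apply] at h
    have h0 : (0 : ℤ) ≤ e dir κ := e_nonneg dir κ
    rw [Pi.add_apply]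
    linarith
  have e4 : ∀ κ, (x + e dir) κ ≤ hi κ + 2 := fun κ => by
    have h : x κ ≤ (hi + 1) κ := hx' κ
    rw [Pi.add_apply, Pi.one_apply] at h
    have h0 : e dir κ ≤ (1 : ℤ) := by rw [e_apply]; split_ifs <;> simp
    rw [Pi.add_apply]
    linarith
  have heq : x' = x + e dir := castSite_inj_big hN e1 e2 e3 e4 htgt'
  subst heq
  rw [gaugeAct_shellGauge_castSite U hN hx hy']
  exact dist1_shellAct_le (shellPlaqSmall_pull hlohi hN hU) hε hd hlohi hn hx hy' ⟨κ₀, hκ₀⟩ ⟨κ₁, hκ₁⟩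

/-- **THE EXTENSION LEMMA OF p. 193 FOR A PARALLELEPIPED, ALL PLAQUETTES** (`d ≥ 3`): for `Λ = boxSites lo hi` (at most
`n + 1` sites per direction, non-wrapping with margin) and `V` with `|V(∂p′) − 1| < ε` on the plaquettes of `Λᶜ`, the
configuration `V̂ = extend Λ (shellGauge V lo hi) V` (i) equals `V` on the bonds of `Λᶜ`, (ii) keeps the plaquette
variables of `Λᶜ`, and (iii) satisfies `|V̂(∂p) − 1| ≤ 12d(n + 2)²ε` on EVERY OTHER plaquette — the printed `O(1)M²ε`,
now including the corner plaquettes of GAPS G-B15-02. [cite: Balaban1989LargeFieldI, p.193] -/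
theorem extension_shell_box (hd : 3 ≤ P.d) (V : GaugeField P k G) (hlohi : lo ≤ hi) {n : ℕ}
    (hn : ∀ κ, hi κ ≤ lo κ + n) (hN : ∀ κ, hi κ - lo κ + 3 < (P.sitesPerDir k : ℤ)) {ε : ℝ} (hε : 0 ≤ ε)
    (hV : PlaqSmallOn (outPlaqs (boxSites lo hi)) ε V) :
    (∀ b ∈ outBonds (boxSites lo hi), extend (boxSites lo hi) (shellGauge V lo hi) V b = V b) ∧
      (∀ p ∈ outPlaqs (boxSites lo hi),
        GaugeField.plaqHol (extend (boxSites lo hi) (shellGauge V lo hi) V) p = GaugeField.plaqHol V p) ∧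
      ∀ p ∉ outPlaqs (boxSites lo hi),
        dist1 (GaugeField.plaqHol (extend (boxSites lo hi) (shellGauge V lo hi) V) p) ≤
          4 * (3 * P.d * (n + 2) ^ 2 * ε) :=
  ⟨fun _ hb => extend_eq_of_mem_outBonds _ V hb, fun _ hp => plaqHol_extend_of_mem_outPlaqs _ V hp,
    fun _ hp => dist1_plaqHol_extend_le_of_corners (T := shellSites lo hi) (shellGauge V lo hi) V (by positivity)
      (fun _ hs ht => dist1_gaugeAct_shellGauge_le hd hlohi hn hN hε hV hs ht)
      (corners_subset_of_not_mem_outPlaqs hp)⟩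

/-- **THE TYPED LEAF `B15.PrelimIntegrations.Extension193` PROVED FOR A PARALLELEPIPED WITH `allP = Set.univ`** (row
`B15.Lem@193`, repair of GAPS G-B15-02 for `d ≥ 3`): `outB` = the bonds of `Λᶜ`, `outP` = the plaquettes of `Λᶜ`, ALL
plaquettes regular for the extension, constant `C = 48d + 1`, any `M ≥ n + 1`: for every `ε` and every `ε`-regular `V` on
`Λᶜ` there is an extension equal to `V` on `Λᶜ` with `|V̂(∂p) − 1| < (48d + 1)M²ε` for EVERY plaquette `p`.
[cite: Balaban1989LargeFieldI, p.193] -/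
theorem extension193_shell_box (hd : 3 ≤ P.d) (hlohi : lo ≤ hi) {n : ℕ} (hn : ∀ κ, hi κ ≤ lo κ + n)
    (hN : ∀ κ, hi κ - lo κ + 3 < (P.sitesPerDir k : ℤ)) {M : ℝ} (hM : (n : ℝ) + 1 ≤ M) (ε : ℝ) :
    B15.PrelimIntegrations.Extension193 (k := k) (G := G) (outBonds (boxSites lo hi)) (outPlaqs (boxSites lo hi))
      Set.univ (48 * (P.d : ℝ) + 1) M ε := by
  intro V hV
  refine ⟨extend (boxSites lo hi) (shellGauge V lo hi) V, fun b hb => extend_eq_of_mem_outBonds _ V hb,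
    fun p _ => ?_⟩
  -- a plaquette exists, so `ε > 0`
  have hε : 0 < ε := lt_of_le_of_lt (GaugeGroup.dist1_nonneg _) (hV _ (corner_plaq_mem_outPlaqs hlohi hN p))
  have hM1 : (1 : ℝ) ≤ M := by have : (0 : ℝ) ≤ n := n.cast_nonneg; linarith
  have hd0 : (0 : ℝ) ≤ (P.d : ℝ) := Nat.cast_nonneg _
  obtain ⟨-, hplaq, hrest⟩ := extension_shell_box hd V hlohi hn hN hε.le hV
  by_cases hp : p ∈ outPlaqs (boxSites lo hi)
  · rw [hplaq p hp]
    calc dist1 (GaugeField.plaqHol V p) < ε := hV p hp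
      _ ≤ (48 * (P.d : ℝ) + 1) * M ^ 2 * ε := by
          have h1 : (1 : ℝ) ≤ (48 * (P.d : ℝ) + 1) * M ^ 2 := by nlinarith
          nlinarith
  · calc dist1 (GaugeField.plaqHol (extend (boxSites lo hi) (shellGauge V lo hi) V) p)
        ≤ 4 * (3 * P.d * (n + 2) ^ 2 * ε) := hrest p hp
      _ < (48 * (P.d : ℝ) + 1) * M ^ 2 * ε := by
          have h1 : ((n : ℝ) + 2) ^ 2 ≤ 4 * M ^ 2 := by nlinarith
          have h2 : (0 : ℝ) < M ^ 2 * ε := by positivity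
          have h3 := mul_le_mul_of_nonneg_left h1 (by positivity : (0 : ℝ) ≤ 12 * (P.d : ℝ) * ε)
          nlinarith

/-- THE `M`-CUBE FORM: a cube of `M ≥ 1` sites per direction (`hi = lo + (M − 1)`), the printed parameter of p. 193
(`Λ` a union of `M`-cubes; here one cube), all plaquettes regular. [cite: Balaban1989LargeFieldI, p.193] -/
theorem extension193_shell_cube (hd : 3 ≤ P.d) {M : ℕ} (hM : 1 ≤ M) (hMN : (M : ℤ) + 2 < (P.sitesPerDir k : ℤ))
    (hcube : ∀ κ, hi κ = lo κ + (M - 1 : ℕ)) (ε : ℝ) :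
    B15.PrelimIntegrations.Extension193 (k := k) (G := G) (outBonds (boxSites lo hi)) (outPlaqs (boxSites lo hi))
      Set.univ (48 * (P.d : ℝ) + 1) M ε := by
  have hlohi : lo ≤ hi := fun κ => by rw [hcube κ]; simp
  have hn : ∀ κ, hi κ ≤ lo κ + (M - 1 : ℕ) := fun κ => (hcube κ).le
  have hN : ∀ κ, hi κ - lo κ + 3 < (P.sitesPerDir k : ℤ) := fun κ => by
    rw [hcube κ]; push_cast [Nat.cast_sub hM]; linarith
  have hMr : (((M - 1 : ℕ) : ℕ) : ℝ) + 1 ≤ (M : ℝ) := by push_cast [Nat.cast_sub hM]; linarith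
  exact extension193_shell_box hd hlohi hn hN hMr ε

end Torus

end Literature.MathematicalPhysics.QuantumFieldTheory.Balaban1983to89.B15ShellGauge193
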